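import Mathlib

/-!
# DepthBoundA4 — the finite-alphabet data model of the widened (A4) road and the DEPTH-BOUND LEMMA as a `Prop`
(plan-lens-HodgeAV-strengthen g6, typing order director-hodge R19.374 (2); pencil statement: hsemireg-colour-1 g2)

Token: line stmt-HodgeConjecture-18881 Cruxes/BlochSeedDiscOne/Lines/birth.lean 814a6a70c14e831a stub_rung_pad4_seedAt.

DATA MODEL (= gs-eng-2 g58 `classwords.py` ∕ hsemireg-colour-1 g2 bus l.8331 ∕ l.8369 ∕ l.8373, the «model of record» for
two-term cell solutions on `X = A₁ × A₂ × A₃ × A₄`, four factors):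
* a LETTER on one factor is `(a; x, y) ∈ ℤ³` = the class `a·h + β̄·e + β·ē`, `β = x + iy ∈ ℤ[i]`, with `h² = 2·pt`, `e·ē = −pt`,
  `h·e = h·ē = e² = ē² = 0`; so `ch(L_(a;β)) = 1 + (a h + β̄ e + β ē) + (a² − |β|²)·pt` and `M² = 2(a² − |β|²)`;
  the HEIGHT-`h` (widened, 1-norm) alphabet is `a + |x| + |y| = h`, `a ≥ 0`; CO-LEVEL `c = |x| + |y|` (= `h − a`), `b = x² + y²`;
  the LINE_h letters are the axis ones (`x·y = 0`), the hub is `(h; 0, 0)`;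
* a CELL is one letter per factor; a DESIGN is a list of N-cells and a list of P-cells with multiplicities (`𝓔 = 𝓝 − 𝓟` in K-theory);
* a WORD is one symbol `1 ∕ h ∕ e ∕ ē ∕ pt` per factor; the CLASS TENSOR `T(D)(w) ∈ ℤ[i]` is `Σ_N m·∏_f coef − Σ_P m·∏_f coef`;
* (A1)-CLEAN: every e-mixed word other than `eeee` ∕ `ēēēē` has `T = 0`, and e-free words of equal total degree agree
  (⇔ the e-free part of `ch(𝓔)` is a polynomial in `h₁ + h₂ + h₃ + h₄`); `μ(D) = T(D)(eeee)`; `rank(D) = Σ_N m − Σ_P m`;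
* AMPLE ABOVE: `(a′; β′)` is amply above `(a; β)` iff `a < a′` and `|β′ − β|² < (a′ − a)²` (the difference class is ample on that
  factor); a P-cell → N-cell incidence is LIVE (four-factor-ample) iff this holds on every factor;
* (A4) FAMILY (colour-1 l.8369): every P-cell has ≥ 1 live arrow out, every N-cell has ≥ 1 live arrow in;
* COPY COUNT `M = Σ_N m + Σ_P m` (fully split atoms: the C4 door count reads `ext² = 28·M ≤ 5 572`, i.e. `M ≤ 199`, colour-1 l.8331 (ii)).

THE LEMMA TO PROVE OR KILL (director R19.374 (2), colour-1's pencil «(A1) ∧ (A4) ∧ M ≤ 199 (∧ r ≥ 8) ⇒ every letter has co-level ≤ c₀»)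
is `DepthBound h B rmin c₀` below (with the `μ ≠ 0` hypothesis of the construction) and its μ-free ∕ rank-free strengthening
`DepthBoundStrong h B c₀`; colour-1's EXACT statement (bus l.8435: six hypotheses incl. (A4♯) «every LIVE arrow is FOUR-AMPLE» and
(CONN)) is `DepthBoundC1` ∕ `DB c₀ := DepthBoundC1 14 199 8 c₀`, her first prover target DB-SYM is `DBSym`; the registered stubs are at the end.  Director R19.375 (1) re-scoping is automatic here: by `no_ample_cover_of_axis` (CLAIM 1 ∕ STRICT-SHRINK,
proved below for every height) every letter of every P-cell of an (A4) design is OFF-AXIS, so the search alphabet for P is the 364 off-axis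
letters per factor; `DepthBoundP` (the bound on P-letters only, the director's wording) is equivalent to `DepthBound` (`depthBound_of_depthBoundP`,
via `colevel_drop_two`).  Either outcome is wanted: a proof closes the (A4) road to a FINITE alphabet (the kit line
«A4-RINGS» then certifies it ring by ring); a counterexample (a deep (A1) ∧ (A4) design with `M ≤ 199`) is the construction's
next address.

This file: definitions (0 `sorry`), the lattice lemmas STRICT-SHRINK ∕ co-level drop ≥ 2 ∕ CLAIM 1 proved for every height, decidable sanity checks (colour-1's Claim 2 instance, LEMMA A instances, the pencil datum's
live arrow), RING 2 EMPTY as a kernel theorem (`ringsEmpty_colevel_two`, ported verbatim from prover s4-search-1 g30),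
RING 3 EMPTY as a kernel theorem (`ringsEmpty_colevel_three`, monad-1's degree-2∕3 functional; so `a4_closed_of_depthBound_three`:
the conjecture of record `DepthBound 14 199 8 3` ALONE closes the (A4) road at M ≤ 199, r ≥ 8),
ONE-ORBIT as a kernel theorem (`one_orbit`, `mP_eq_one`, `sumP_ge_64`: the (BGT) step of DB-SYM — under S₀-invariance the P-support is one
free S₀-orbit of 64 cells of multiplicity 1; sorry-free support for `stub_DBSym`),
PROFILE NORMAL FORM (`profile_normal_form`, `A1_rows_profile`, `sumN_window`: with P = one orbit the (A1) e-free rows read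
`Σ_N m·(ic w − ic w') = 64·(ic x₀ w − ic x₀ w')`, `Σ_P m = 64`, `72 ≤ Σ_N m ≤ 135`; admissibility `N_above_orbit` ∕ `N_colevel_le` —
the prover's starting line for the PROFILE step),
S₀ KILLS MIXED WORDS (`coef_rotPow`, `cellCoef_rotCell_phase`, `linG_rot`, `S0_kills_mixed`, `A1_mixed_automatic`, `A1_iff_efree_rows`: the (A1).1 half
is AUTOMATIC for S₀-invariant designs), μ NORMAL FORM (`rotPhase_eeee`, `linGP_eeee`, `mu_normal_form : μ = Σ_N m·cellCoef(·,eeee) − 64·∏ star β(x₀)`),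
and the hand-off `DBSym_of_profile : DBSymProfile → DBSym` (v1.8),
and TWO registered `sorry` stubs (`stub_DBSym`, `stub_depthBound_three`; v1's `∃ c₀` stub was vacuous — idea-crit-6 l.8439 — and is
replaced by `DB_fourteen_trivial` as a warning sign).  `import Mathlib` only; no `axiom` ∕ `instance` declarations ∕ `unsafe` ∕ `native_decide`.
Chern-character words on a letter model ≠ sheaves ≠ the kernel of a SEED; nothing here is proved toward HC/HC_CM/HC_AV/№4/26512/18881/H2.
-/

set_option linter.dupNamespace false
set_option autoImplicit false

namespace Summit.HodgeConjecture.HodgeConjecture.Cruxes.BlochSeedDiscOne.DepthBoundA4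

/-! ## Letters, cells, designs -/

/-- A letter on one factor: the class `a·h + β̄·e + β·ē`, `β = x + i y`. -/
structure Letter where
  a : ℤ
  x : ℤ
  y : ℤ
deriving DecidableEq, Repr

namespace Letter

/-- `β = x + i y ∈ ℤ[i]`. -/
def beta (ℓ : Letter) : GaussianInt := ⟨ℓ.x, ℓ.y⟩

/-- 1-norm height `a + |x| + |y|` (the widened alphabet of colour-1 ∕ gs-eng-2 is `height = h`, `0 ≤ a`). -/
def height (ℓ : Letter) : ℤ := ℓ.a + |ℓ.x| + |ℓ.y|

/-- Co-level `|x| + |y|` (= `h − a` on the height-`h` alphabet). -/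
def colevel (ℓ : Letter) : ℤ := |ℓ.x| + |ℓ.y|

/-- `b = |β|² = x² + y²`. -/
def bnorm (ℓ : Letter) : ℤ := ℓ.x ^ 2 + ℓ.y ^ 2

/-- `n = a² − |β|²` = the `pt`-coefficient of `ch(L)`; `M² = 2 n`. -/
def selfInt (ℓ : Letter) : ℤ := ℓ.a ^ 2 - ℓ.bnorm

/-- Axis (= LINE_h) letters: `x·y = 0`. -/
def isAxis (ℓ : Letter) : Prop := ℓ.x * ℓ.y = 0

/-- The hub `(h; 0, 0)`. -/
def hub (h : ℤ) : Letter := ⟨h, 0, 0⟩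

/-- Membership in the height-`h` widened alphabet. -/
def OnAlphabet (h : ℤ) (ℓ : Letter) : Prop := ℓ.height = h ∧ 0 ≤ ℓ.a

end Letter

/-- `ℓ′` is AMPLY ABOVE `ℓ`: the difference class `(a′ − a; β′ − β)` is ample, i.e. `a < a′` and `|β′ − β|² < (a′ − a)²`. -/
def AmpleAbove (ℓ ℓ' : Letter) : Prop :=
  ℓ.a < ℓ'.a ∧ (ℓ'.x - ℓ.x) ^ 2 + (ℓ'.y - ℓ.y) ^ 2 < (ℓ'.a - ℓ.a) ^ 2

/-- A cell: one letter per factor (four factors). -/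
abbrev Cell := Fin 4 → Letter

/-- LIVE incidence `x → y` (P-cell `x`, N-cell `y`): amply above on every factor («four-factor-ample»). -/
def Live (x y : Cell) : Prop := ∀ f : Fin 4, AmpleAbove (x f) (y f)

/-- A two-term design `𝓔 = 𝓝 − 𝓟`: N-cells and P-cells with multiplicities (entries with multiplicity `0` are ignored). -/
structure Design where
  N : List (Cell × ℕ)
  P : List (Cell × ℕ)

namespace Design

/-- The support: entries with positive multiplicity. -/
def suppN (D : Design) : List Cell := (D.N.filter fun cm => 0 < cm.2).map Prod.fst
/-- The support on the P side. -/
def suppP (D : Design) : List Cell := (D.P.filter fun cm => 0 < cm.2).map Prod.fst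

/-- Copy count `M = Σ_N m + Σ_P m`. -/
def copies (D : Design) : ℕ := (D.N.map Prod.snd).sum + (D.P.map Prod.snd).sum

/-- Rank `r = Σ_N m − Σ_P m`. -/
def rank (D : Design) : ℤ := ((D.N.map Prod.snd).sum : ℤ) - ((D.P.map Prod.snd).sum : ℤ)

/-- Every letter of every cell of the support lies in the height-`h` alphabet. -/
def OnAlphabet (h : ℤ) (D : Design) : Prop :=
  ∀ c ∈ D.suppN ++ D.suppP, ∀ f : Fin 4, (c f).OnAlphabet h

/-- (A4) FAMILY: every P-cell has a live arrow out, every N-cell has a live arrow in. -/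
def A4 (D : Design) : Prop :=
  (∀ x ∈ D.suppP, ∃ y ∈ D.suppN, Live x y) ∧ (∀ y ∈ D.suppN, ∃ x ∈ D.suppP, Live x y)

end Design

/-! ## Class words and the (A1) condition -/

/-- One symbol per factor: `1, h, e, ē, pt`. -/
inductive Sym where
  | one | h | e | ebar | pt
deriving DecidableEq, Repr, Fintype

namespace Sym

/-- Cohomological half-degree: `h, e, ē` have degree 1, `pt` degree 2. -/
def deg : Sym → ℕ
  | one => 0 | h => 1 | e => 1 | ebar => 1 | pt => 2

/-- e-free symbols `1, h, pt`. -/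
def efree : Sym → Bool
  | one => true | h => true | pt => true | e => false | ebar => false

/-- The coefficient of a symbol in `ch(L_(a;β)) = 1 + (a h + β̄ e + β ē) + (a² − |β|²) pt`, as a Gaussian integer. -/
def coef : Sym → Letter → GaussianInt
  | one, _ => 1
  | h, ℓ => (ℓ.a : GaussianInt)
  | e, ℓ => star ℓ.beta
  | ebar, ℓ => ℓ.beta
  | pt, ℓ => (ℓ.selfInt : GaussianInt)

end Sym

/-- A word: one symbol per factor. -/
abbrev Word := Fin 4 → Sym

namespace Word

/-- Total degree. -/
def deg (w : Word) : ℕ := ∑ f : Fin 4, (w f).deg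

/-- e-free word (symbols in `{1, h, pt}` on every factor). -/
def efree (w : Word) : Prop := ∀ f : Fin 4, (w f).efree = true

/-- The Bloch words `eeee` and `ēēēē`. -/
def eeee : Word := fun _ => Sym.e
/-- `ēēēē`. -/
def EEEE : Word := fun _ => Sym.ebar
/-- The unit word `1111` (its tensor coefficient is the rank). -/
def unit : Word := fun _ => Sym.one

end Word

/-- Coefficient of a word in `ch` of a cell `= ∏_f coef`. -/
def cellCoef (c : Cell) (w : Word) : GaussianInt := ∏ f : Fin 4, (w f).coef (c f)

/-- The class tensor `T(D)(w) = Σ_N m·cellCoef − Σ_P m·cellCoef ∈ ℤ[i]`. -/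
def Design.T (D : Design) (w : Word) : GaussianInt :=
  (D.N.map fun cm => (cm.2 : GaussianInt) * cellCoef cm.1 w).sum
    - (D.P.map fun cm => (cm.2 : GaussianInt) * cellCoef cm.1 w).sum

/-- `μ(D) = T(D)(eeee)` — the coefficient of the Bloch word. -/
def Design.mu (D : Design) : GaussianInt := D.T Word.eeee

/-- (A1)-CLEAN: every e-mixed word other than `eeee` ∕ `ēēēē` vanishes, and e-free words of equal degree agree. -/
def Design.A1 (D : Design) : Prop :=
  (∀ w : Word, ¬ w.efree → w ≠ Word.eeee → w ≠ Word.EEEE → D.T w = 0) ∧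
  (∀ w w' : Word, w.efree → w'.efree → w.deg = w'.deg → D.T w = D.T w')

/-! ## The DEPTH-BOUND LEMMA as a `Prop` -/

/-- DEPTH BOUND (construction form): on the height-`h` alphabet, an (A1)-clean (A4) design with `μ ≠ 0`, copy count `≤ B`
and rank `≥ rmin` uses only letters of co-level `≤ c₀`. -/
def DepthBound (h : ℤ) (B : ℕ) (rmin : ℤ) (c₀ : ℤ) : Prop :=
  ∀ D : Design, D.OnAlphabet h → D.A1 → D.A4 → D.mu ≠ 0 → D.copies ≤ B → rmin ≤ D.rank →
    ∀ c ∈ D.suppN ++ D.suppP, ∀ f : Fin 4, (c f).colevel ≤ c₀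

/-- DEPTH BOUND (strong form, μ-free and rank-free — colour-1's pencil «(A1) ∧ (A4) ∧ M ≤ B ⇒ co-level ≤ c₀»). -/
def DepthBoundStrong (h : ℤ) (B : ℕ) (c₀ : ℤ) : Prop :=
  ∀ D : Design, D.OnAlphabet h → D.A1 → D.A4 → D.copies ≤ B →
    ∀ c ∈ D.suppN ++ D.suppP, ∀ f : Fin 4, (c f).colevel ≤ c₀

theorem depthBound_of_strong (h : ℤ) (B : ℕ) (rmin c₀ : ℤ) (hs : DepthBoundStrong h B c₀) :
    DepthBound h B rmin c₀ :=
  fun D hA h1 h4 _ hB _ => hs D hA h1 h4 hB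

theorem depthBound_mono (h : ℤ) (B B' : ℕ) (rmin rmin' c₀ c₀' : ℤ) (hB : B' ≤ B) (hr : rmin ≤ rmin')
    (hc : c₀ ≤ c₀') (hd : DepthBound h B rmin c₀) : DepthBound h B' rmin' c₀' :=
  fun D hA h1 h4 hμ hB' hr' c hc' f =>
    le_trans (hd D hA h1 h4 hμ (le_trans hB' hB) (le_trans hr hr') c hc' f) hc

/-- (A4) ROAD CLOSED ON A FINITE ALPHABET: the form the kit line «A4-RINGS» certifies ring by ring —
no (A1)-clean (A4) design with `μ ≠ 0`, `M ≤ B`, rank `≥ rmin` whose letters all have co-level `≤ c₀`. -/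
def RingsEmpty (h : ℤ) (B : ℕ) (rmin : ℤ) (c₀ : ℤ) : Prop :=
  ∀ D : Design, D.OnAlphabet h → D.A1 → D.A4 → D.mu ≠ 0 → D.copies ≤ B → rmin ≤ D.rank →
    (∀ c ∈ D.suppN ++ D.suppP, ∀ f : Fin 4, (c f).colevel ≤ c₀) → False

/-- The two-piece CLOSURE of the widened (A4) road (director R19.374 (3)): depth bound + ring certificates ⇒ no design at all. -/
theorem a4_closed_of_depthBound_and_rings (h : ℤ) (B : ℕ) (rmin c₀ : ℤ)
    (hd : DepthBound h B rmin c₀) (hr : RingsEmpty h B rmin c₀) :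
    ∀ D : Design, D.OnAlphabet h → D.A1 → D.A4 → D.mu ≠ 0 → D.copies ≤ B → rmin ≤ D.rank → False :=
  fun D hA h1 h4 hμ hB hrk => hr D hA h1 h4 hμ hB hrk (hd D hA h1 h4 hμ hB hrk)

/-! ## Lattice lemmas in the kernel: STRICT-SHRINK (idea-crit-hsem-2 g4, bus l.8378), co-level drop ≥ 2 (colour-1 LEMMA A's
co-level half, l.8373), CLAIM 1 (colour-1 l.8369: axis letters have no ample cover) — for EVERY height `h`, not only 14. -/

theorem sq_abs_sub_abs_le (u v : ℤ) : (|u| - |v|) ^ 2 ≤ (v - u) ^ 2 := by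
  have h1 : |(|u| - |v|)| ≤ |u - v| := abs_abs_sub_abs_le_abs_sub u v
  have h2 : |(|u| - |v|)| ^ 2 ≤ |u - v| ^ 2 := pow_le_pow_left₀ (abs_nonneg _) h1 2
  rw [sq_abs, sq_abs] at h2
  have : (u - v) ^ 2 = (v - u) ^ 2 := by ring
  linarith

/-- STRICT-SHRINK: along an ample step between two letters of the same 1-norm height, `|x|` AND `|y|` both drop by ≥ 1
(so the upper letter lies strictly inside the lower letter's box). -/
theorem strict_shrink (ℓ ℓ' : Letter) (hh : ℓ.height = ℓ'.height) (hA : AmpleAbove ℓ ℓ') :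
    |ℓ'.x| + 1 ≤ |ℓ.x| ∧ |ℓ'.y| + 1 ≤ |ℓ.y| := by
  obtain ⟨_, hlt⟩ := hA
  unfold Letter.height at hh
  set p := |ℓ.x| - |ℓ'.x| with hp
  set q := |ℓ.y| - |ℓ'.y| with hq'
  have hd : ℓ'.a - ℓ.a = p + q := by rw [hp, hq']; linarith
  have hx := sq_abs_sub_abs_le ℓ.x ℓ'.x
  have hy := sq_abs_sub_abs_le ℓ.y ℓ'.y
  have hpq : p ^ 2 + q ^ 2 < (p + q) ^ 2 := by rw [← hd]; linarith
  have hprod : 0 < p * q := by nlinarith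
  have hsum : 0 < p + q := by linarith
  have hp1 : 0 < p := by
    by_contra hc
    have hc' : p ≤ 0 := not_lt.mp hc
    have hq0 : 0 < q := by linarith
    nlinarith
  have hq1 : 0 < q := by
    by_contra hc
    have hc' : q ≤ 0 := not_lt.mp hc
    nlinarith
  constructor <;> omega

/-- Co-level drops by at least 2 along every ample step inside one height (colour-1's machine datum «min co-level drop = 2»). -/
theorem colevel_drop_two (ℓ ℓ' : Letter) (hh : ℓ.height = ℓ'.height) (hA : AmpleAbove ℓ ℓ') :
    ℓ'.colevel + 2 ≤ ℓ.colevel := by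
  obtain ⟨hx, hy⟩ := strict_shrink ℓ ℓ' hh hA
  unfold Letter.colevel
  omega

/-- CLAIM 1 (colour-1), for every height: an AXIS letter (`x·y = 0`, i.e. a LINE letter) has no ample cover of the same height.
In particular no incidence between LINE letters is ample on any factor (MEMO-05 LEMMA 1 ∕ `StrengthenLineCone`, ledger #71),
and every letter of every P-cell of an (A4) design is off-axis. -/
theorem no_ample_cover_of_axis (ℓ ℓ' : Letter) (hh : ℓ.height = ℓ'.height) (hax : ℓ.isAxis) :
    ¬ AmpleAbove ℓ ℓ' := by
  intro hA
  obtain ⟨hx, hy⟩ := strict_shrink ℓ ℓ' hh hA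
  unfold Letter.isAxis at hax
  rcases mul_eq_zero.mp hax with h0 | h0
  · rw [h0, abs_zero] at hx
    have := abs_nonneg ℓ'.x
    omega
  · rw [h0, abs_zero] at hy
    have := abs_nonneg ℓ'.y
    omega

/-- The director's wording (R19.375 (1)): the bound on P-letters only. -/
def DepthBoundP (h : ℤ) (B : ℕ) (rmin : ℤ) (c₀ : ℤ) : Prop :=
  ∀ D : Design, D.OnAlphabet h → D.A1 → D.A4 → D.mu ≠ 0 → D.copies ≤ B → rmin ≤ D.rank →
    ∀ c ∈ D.suppP, ∀ f : Fin 4, (c f).colevel ≤ c₀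

theorem depthBoundP_of_depthBound (h : ℤ) (B : ℕ) (rmin c₀ : ℤ) (hd : DepthBound h B rmin c₀) :
    DepthBoundP h B rmin c₀ :=
  fun D hA h1 h4 hμ hB hr c hc f => hd D hA h1 h4 hμ hB hr c (List.mem_append.mpr (Or.inr hc)) f

/-- … and conversely, by STRICT-SHRINK the N-letters of an (A4) design sit ≥ 2 co-levels above some P-letter on every factor,
so a bound `c₀` on P-letters bounds every letter (by `c₀`, indeed by `c₀ − 2` on the N side). -/
theorem depthBound_of_depthBoundP (h : ℤ) (B : ℕ) (rmin c₀ : ℤ) (hd : DepthBoundP h B rmin c₀) :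
    DepthBound h B rmin c₀ := by
  intro D hA h1 h4 hμ hB hr c hc f
  rcases List.mem_append.mp hc with hN | hP
  · obtain ⟨x, hx, hlive⟩ := h4.2 c hN
    have hxc : (x f).colevel ≤ c₀ := hd D hA h1 h4 hμ hB hr x hx f
    have hhx : (x f).height = h := (hA x (List.mem_append.mpr (Or.inr hx)) f).1
    have hhc : (c f).height = h := (hA c hc f).1
    have := colevel_drop_two (x f) (c f) (hhx.trans hhc.symm) (hlive f)
    linarith
  · exact hd D hA h1 h4 hμ hB hr c hP f

/-! ## Decidable sanity checks (colour-1 l.8369 ∕ l.8373 instances; `decide` on integer arithmetic) -/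

section checks

/-- The hub is amply above `(12; 1, 1)` (Claim 2's cover). -/
example : AmpleAbove ⟨12, 1, 1⟩ (Letter.hub 14) := by
  unfold AmpleAbove; decide
/-- … and nothing at level 13 is: e.g. `(13; 1, 0)`, `(13; 0, 1)` are not amply above `(12; 1, 1)` (Δa = 1 needs |Δβ|² < 1). -/
example : ¬ AmpleAbove ⟨12, 1, 1⟩ ⟨13, 1, 0⟩ := by
  unfold AmpleAbove; decide
example : ¬ AmpleAbove ⟨12, 1, 1⟩ ⟨13, 0, 1⟩ := by
  unfold AmpleAbove; decide
/-- Claim 1 instances (axis letters have no ample cover among height-14 letters): `(12; 2, 0)` is not amply below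
`(14; 0, 0)`, `(13; 1, 0)`, `(13; 0, 1)`. -/
example : ¬ AmpleAbove ⟨12, 2, 0⟩ (Letter.hub 14) := by
  unfold AmpleAbove; decide
example : ¬ AmpleAbove ⟨12, 2, 0⟩ ⟨13, 1, 0⟩ := by
  unfold AmpleAbove; decide
example : ¬ AmpleAbove ⟨12, 2, 0⟩ ⟨13, 0, 1⟩ := by
  unfold AmpleAbove; decide
/-- No LINE letter is amply below another (MEMO-05 LEMMA 1 ∕ `StrengthenLineCone`), two instances. -/
example : ¬ AmpleAbove ⟨12, 0, 2⟩ ⟨13, 0, 1⟩ := by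
  unfold AmpleAbove; decide
example : ¬ AmpleAbove ⟨13, 0, 1⟩ (Letter.hub 14) := by
  unfold AmpleAbove; decide
/-- LEMMA A instance: along the ample incidence `(11; 2, 1) → (13; 1, 0)`, `b` drops by `5 − 1 ≥ 2` and co-level by `2`. -/
example : AmpleAbove ⟨11, 2, 1⟩ ⟨13, 1, 0⟩ ∧ Letter.bnorm ⟨11, 2, 1⟩ = 5 ∧ Letter.bnorm ⟨13, 1, 0⟩ = 1 := by
  unfold AmpleAbove Letter.bnorm; decide
/-- Heights and co-levels of the letters used above. -/
example : Letter.height ⟨12, 1, 1⟩ = 14 ∧ Letter.colevel ⟨12, 1, 1⟩ = 2 ∧ Letter.height ⟨11, 2, 1⟩ = 14 ∧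
    Letter.colevel ⟨11, 2, 1⟩ = 3 ∧ Letter.selfInt ⟨12, 1, 1⟩ = 142 ∧ Letter.selfInt (Letter.hub 14) = 196 := by decide
/-- The size of the height-14 alphabet ring by ring: co-level `c ≥ 1` has `4c` letters, `1 + Σ_{c ≤ 14} 4c = 421`. -/
example : 1 + ∑ c ∈ Finset.range 15, 4 * c = 421 := by decide
/-- The door count on the fully split (A4) family: `28·M ≤ 5 572 ⇔ M ≤ 199`. -/
example : 28 * 199 = 5572 := by decide

/-- colour-1's pencil datum, the letter half: the degree-2 e-free equality on `P = (12; 1+i)`-type cells vs the hub reads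
`144·M_P` vs `142·M_P` per P-copy (a² = 144, a² − b = 142), which forces `M_P = 0`. -/
example : (12 : ℤ) ^ 2 = 144 ∧ (12 : ℤ) ^ 2 - (1 ^ 2 + 1 ^ 2) = 142 ∧ (144 : ℤ) ≠ 142 := by decide

end checks

/-! ## hsemireg-colour-1 g2's exact statement DB(c₀) and the first prover target DB-SYM (bus l.8435, memo
`hsemireg-colour-1/memo/DEPTH-BOUND-STATEMENT-colour1-g2.md` d4eb503f97e7eb29)

Per factor an incidence `σ_f → τ_f` is EQUAL ∕ NULL ∕ AMPLE ∕ DEAD by the sign of `Δ² − |dβ|²` (`Δ = a(τ_f) − a(σ_f) > 0` required unless equal);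
LIVE = no DEAD factor; FOUR-AMPLE = all four AMPLE (= `Live` above).  colour-1's hypotheses: (A1); (MU) `μ ≠ 0`; (RK) rank `≥ 8`;
(A4♯) every LIVE arrow between supported cells is FOUR-AMPLE; (CONN) every supported P-cell has a LIVE arrow out and every supported
N-cell a LIVE arrow in (load-bearing: without it ring 3 is LP-feasible); (BGT) `M ≤ 199`.  Conclusion of DB(c₀): every letter of every
supported P-cell has co-level `≤ c₀` (then N-letters `≤ c₀ − 2` by `colevel_drop_two`).  HONEST STATUS (colour-1): no `c₀ < 14` is proved;
DB(14) is trivial (idea-crit-6 l.8439: so an `∃ c₀` stub is VACUOUS — v1 of this file had one; removed).  The registered stubs below are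
DB-SYM (all depths, no `c₀`) and the conjecture of record `DepthBound 14 199 8 3` (colour-1's numeral l.8441, director R19.377 (1)) —
`3` = the co-level through which the A4-RINGS certificates say EMPTY tonight (gs-eng-2 g58 ×2, given CONN), so that
`DepthBound 14 199 8 3 ∧ RingsEmpty 14 199 8 3` is the closing shape; `DB 3` (six hypotheses) follows (`DB_three_of_depthBound_three`);
both bounds are monotone in `c₀` (`depthBound_mono`, `DB_mono`), so a higher certified ring weakens the target. -/

/-- Per-factor step that is NOT DEAD: equal letters, or `a < a′` with `|dβ|² ≤ Δ²` (NULL if `=`, AMPLE if `<`). -/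
def NotDead (ℓ ℓ' : Letter) : Prop :=
  ℓ = ℓ' ∨ (ℓ.a < ℓ'.a ∧ (ℓ'.x - ℓ.x) ^ 2 + (ℓ'.y - ℓ.y) ^ 2 ≤ (ℓ'.a - ℓ.a) ^ 2)

/-- LIVE in colour-1's sense (weak): no DEAD factor. -/
def WeakLive (x y : Cell) : Prop := ∀ f : Fin 4, NotDead (x f) (y f)

theorem weakLive_of_live (x y : Cell) (h : Live x y) : WeakLive x y :=
  fun f => Or.inr ⟨(h f).1, le_of_lt (h f).2⟩

namespace Design

/-- (A4♯) (colour-1): every LIVE arrow between supported cells is FOUR-AMPLE. -/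
def A4sharp (D : Design) : Prop :=
  ∀ x ∈ D.suppP, ∀ y ∈ D.suppN, WeakLive x y → Live x y

/-- (CONN) (colour-1): every supported P-cell has a LIVE arrow out, every supported N-cell a LIVE arrow in. -/
def CONN (D : Design) : Prop :=
  (∀ x ∈ D.suppP, ∃ y ∈ D.suppN, WeakLive x y) ∧ (∀ y ∈ D.suppN, ∃ x ∈ D.suppP, WeakLive x y)

/-- Under (A4♯), (CONN) is the same as this file's `A4` (∃ a FOUR-AMPLE arrow out ∕ in). -/
theorem a4_of_sharp_conn (D : Design) (hs : D.A4sharp) (hc : D.CONN) : D.A4 := by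
  refine ⟨fun x hx => ?_, fun y hy => ?_⟩
  · obtain ⟨y, hy, hw⟩ := hc.1 x hx
    exact ⟨y, hy, hs x hx y hy hw⟩
  · obtain ⟨x, hx, hw⟩ := hc.2 y hy
    exact ⟨x, hx, hs x hx y hy hw⟩

theorem conn_of_a4 (D : Design) (h : D.A4) : D.CONN :=
  ⟨fun x hx => by obtain ⟨y, hy, hl⟩ := h.1 x hx; exact ⟨y, hy, weakLive_of_live x y hl⟩,
   fun y hy => by obtain ⟨x, hx, hl⟩ := h.2 y hy; exact ⟨x, hx, weakLive_of_live x y hl⟩⟩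

/-- Multiplicity functions of a list-presented design (entries with the same cell add up). -/
def mN (D : Design) (c : Cell) : ℕ := ((D.N.filter fun cm => cm.1 = c).map Prod.snd).sum
/-- Multiplicity on the P side. -/
def mP (D : Design) (c : Cell) : ℕ := ((D.P.filter fun cm => cm.1 = c).map Prod.snd).sum

end Design

/-- colour-1's DEPTH BOUND with all six hypotheses, general parameters. -/
def DepthBoundC1 (h : ℤ) (B : ℕ) (rmin : ℤ) (c₀ : ℤ) : Prop :=
  ∀ D : Design, D.OnAlphabet h → D.A1 → D.mu ≠ 0 → rmin ≤ D.rank → D.A4sharp → D.CONN → D.copies ≤ B →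
    ∀ c ∈ D.suppP, ∀ f : Fin 4, (c f).colevel ≤ c₀

/-- **DB(c₀)** — colour-1's statement verbatim: `h = 14`, `B = 199`, `rmin = 8`. -/
def DB (c₀ : ℕ) : Prop := DepthBoundC1 14 199 8 c₀

theorem DB_mono (c₀ c₀' : ℕ) (hle : c₀ ≤ c₀') (h : DB c₀) : DB c₀' :=
  fun D hA h1 hμ hr hs hc hB x hx f => le_trans (h D hA h1 hμ hr hs hc hB x hx f) (by exact_mod_cast hle)

/-- `DepthBoundP` (this file's ∃-FOUR-AMPLE form, without (A4♯)) implies colour-1's DB. -/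
theorem depthBoundC1_of_depthBoundP (h : ℤ) (B : ℕ) (rmin c₀ : ℤ) (hd : DepthBoundP h B rmin c₀) :
    DepthBoundC1 h B rmin c₀ :=
  fun D hA h1 hμ hr hs hc hB x hx f => hd D hA h1 (D.a4_of_sharp_conn hs hc) hμ hB hr x hx f

/-- DB(14) is TRIVIAL (co-level `= 14 − a ≤ 14` on the alphabet) — recorded so that no seat mistakes it for content
(idea-crit-6 l.8439). -/
theorem DB_fourteen_trivial : DB 14 := by
  intro D hA _ _ _ _ _ _ x hx f
  have h1 := (hA x (List.mem_append.mpr (Or.inr hx)) f)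
  simp only [Letter.OnAlphabet, Letter.height] at h1
  simp only [Letter.colevel]
  push_cast
  omega

/-! ### The rotation group `S₀` and DB-SYM -/

/-- Quarter turn `β ↦ i·β` on one letter: `(x, y) ↦ (−y, x)`, level fixed. -/
def Letter.rotI (ℓ : Letter) : Letter := ⟨ℓ.a, -ℓ.y, ℓ.x⟩

/-- `k`-fold quarter turn. -/
def Letter.rotPow (k : ℕ) (ℓ : Letter) : Letter := Letter.rotI^[k] ℓ

/-- Factorwise rotation of a cell by `k : Fin 4 → Fin 4` quarter turns. -/
def rotCell (k : Fin 4 → Fin 4) (c : Cell) : Cell := fun f => Letter.rotPow (k f).val (c f)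

/-- `S₀ = {k ∈ (ℤ∕4)⁴ : Σ_f k_f ≡ 0 (mod 4)}` — colour-1 ∕ crit-hsem-2: the unique rotation subgroup whose orbit sums kill every
e-mixed word and keep `μ`. -/
def InS0 (k : Fin 4 → Fin 4) : Prop := (∑ f : Fin 4, (k f).val) % 4 = 0

/-- `S₀`-invariance of a design: both multiplicity functions are invariant under every `k ∈ S₀`. -/
def Design.S0Invariant (D : Design) : Prop :=
  ∀ k : Fin 4 → Fin 4, InS0 k → ∀ c : Cell, D.mN (rotCell k c) = D.mN c ∧ D.mP (rotCell k c) = D.mP c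

/-- **DB-SYM** (colour-1's FIRST prover target, all depths, no `c₀`): no `S₀`-invariant design on the height-14 alphabet satisfies
(A1) ∧ (MU) ∧ (RK) ∧ (A4♯) ∧ (CONN) ∧ (BGT).  (Her pencil: (BGT) forces exactly one P-orbit, 64 ≤ Σm_P ≤ 95 < 128, so P has a constant
`(a_f, b_f)`-vector; (K3) kills the level-uniform case already.) -/
def DBSym : Prop :=
  ∀ D : Design, D.S0Invariant → D.OnAlphabet 14 → D.A1 → D.mu ≠ 0 → 8 ≤ D.rank → D.A4sharp → D.CONN → D.copies ≤ 199 → False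

section checks2
/-- `rotI` is a quarter turn: four of them are the identity on a sample letter; NULL vs AMPLE vs DEAD samples. -/
example : Letter.rotPow 4 ⟨11, 2, 1⟩ = ⟨11, 2, 1⟩ ∧ Letter.rotPow 1 ⟨11, 2, 1⟩ = ⟨11, -1, 2⟩ := by decide
example : NotDead ⟨12, 0, 2⟩ ⟨13, 0, 1⟩ ∧ ¬ AmpleAbove ⟨12, 0, 2⟩ ⟨13, 0, 1⟩ := by
  unfold NotDead AmpleAbove; decide
example : ¬ NotDead ⟨12, 1, 1⟩ ⟨13, -1, 0⟩ := by unfold NotDead; decide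
example : InS0 ![1, 1, 1, 1] ∧ InS0 ![1, 3, 0, 0] ∧ ¬ InS0 ![1, 0, 0, 0] := by unfold InS0; decide
end checks2

/-! ## RING 2 IS EMPTY — kernel theorem (ported VERBATIM from prover s4-search-1 g30's
`s4push/search-1/code/g30/depth/DepthBoundKernel.lean` f4ed1b650c5b6962 §2.2–§2.5, written over a byte-identical copy of this data
model; idea-crit-6 KERNEL PLATE PASS 27∕27 l.8500; landed here so that `RingsEmpty 14 B rmin 2` is a theorem about the decls of record).
(K1) of hsemireg-colour-1 g2 (l.8369): on the height-14 alphabet, (A4) forces every P-letter to be `(12; ±1, ±1)` and every N-letter to be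
the hub; the degree-2 e-free (A1) row `T(h h 1 1) = T(pt 1 1 1)` then reads `0·Σ_N m − 2·Σ_P m = 0`, so `Σ_P m = 0`, the supports are
empty and `μ = 0` — contradiction; valid for every budget `B` and rank floor `rmin`. -/

section prover_s4search1

/-- on the height-`h` alphabet the co-level of a letter is `h − a ≤ h`. -/
theorem colevel_le_of_onAlphabet {h : ℤ} {ℓ : Letter} (hℓ : ℓ.OnAlphabet h) : ℓ.colevel ≤ h := by
  obtain ⟨hh, ha⟩ := hℓ
  unfold Letter.height at hh
  unfold Letter.colevel
  linarith

/-- DB(h) is trivial (cf. `DB_fourteen_trivial`): the all-letter form at `c₀ = h`. -/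
theorem depthBound_self (h : ℤ) (B : ℕ) (rmin : ℤ) : DepthBound h B rmin h :=
  fun _ hA _ _ _ _ _ c hc f => colevel_le_of_onAlphabet (hA c hc f)

/-! ## §2.2 List bookkeeping for the class tensor -/

theorem mem_suppP_iff (D : Design) (c : Cell) : c ∈ D.suppP ↔ ∃ m : ℕ, (c, m) ∈ D.P ∧ 0 < m := by
  unfold Design.suppP
  constructor
  · intro hc
    obtain ⟨cm, hcm, rfl⟩ := List.mem_map.mp hc
    obtain ⟨hmem, hpos⟩ := List.mem_filter.mp hcm
    exact ⟨cm.2, hmem, by simpa using hpos⟩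
  · rintro ⟨m, hmem, hpos⟩
    exact List.mem_map.mpr ⟨(c, m), List.mem_filter.mpr ⟨hmem, by simpa using hpos⟩, rfl⟩

theorem mem_suppN_iff (D : Design) (c : Cell) : c ∈ D.suppN ↔ ∃ m : ℕ, (c, m) ∈ D.N ∧ 0 < m := by
  unfold Design.suppN
  constructor
  · intro hc
    obtain ⟨cm, hcm, rfl⟩ := List.mem_map.mp hc
    obtain ⟨hmem, hpos⟩ := List.mem_filter.mp hcm
    exact ⟨cm.2, hmem, by simpa using hpos⟩
  · rintro ⟨m, hmem, hpos⟩
    exact List.mem_map.mpr ⟨(c, m), List.mem_filter.mpr ⟨hmem, by simpa using hpos⟩, rfl⟩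

/-- difference of two weighted sums over the same list of (cell, multiplicity) entries. -/
theorem wsum_sub (L : List (Cell × ℕ)) (u v : Cell → GaussianInt) :
    (L.map fun cm => (cm.2 : GaussianInt) * u cm.1).sum - (L.map fun cm => (cm.2 : GaussianInt) * v cm.1).sum =
      (L.map fun cm => (cm.2 : GaussianInt) * (u cm.1 - v cm.1)).sum := by
  induction L with
  | nil => simp
  | cons a t ih =>
    simp only [List.map_cons, List.sum_cons]
    linear_combination ih

/-- if every entry with positive multiplicity has `u = v + d`, the weighted difference is `d · Σ m`. -/
theorem wsum_sub_const (L : List (Cell × ℕ)) (u v : Cell → GaussianInt) (d : GaussianInt)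
    (h : ∀ cm ∈ L, 0 < cm.2 → u cm.1 - v cm.1 = d) :
    (L.map fun cm => (cm.2 : GaussianInt) * u cm.1).sum - (L.map fun cm => (cm.2 : GaussianInt) * v cm.1).sum =
      d * ((L.map Prod.snd).sum : ℕ) := by
  rw [wsum_sub]
  induction L with
  | nil => simp
  | cons a t ih =>
    simp only [List.map_cons, List.sum_cons, Nat.cast_add]
    have ht : ∀ cm ∈ t, 0 < cm.2 → u cm.1 - v cm.1 = d := fun cm hcm => h cm (List.mem_cons_of_mem _ hcm)
    rw [ih ht]
    rcases Nat.eq_zero_or_pos a.2 with h0 | hpos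
    · simp [h0]
    · rw [h a List.mem_cons_self hpos]
      ring

/-- a weighted sum all of whose positive-multiplicity entries carry coefficient `0`… is `0`; in particular when the list has NO
positive multiplicity at all. -/
theorem wsum_eq_zero_of_mults_zero (L : List (Cell × ℕ)) (u : Cell → GaussianInt)
    (h : ∀ cm ∈ L, cm.2 = 0) : (L.map fun cm => (cm.2 : GaussianInt) * u cm.1).sum = 0 := by
  induction L with
  | nil => simp
  | cons a t ih =>
    simp only [List.map_cons, List.sum_cons]
    rw [ih fun cm hcm => h cm (List.mem_cons_of_mem _ hcm), h a List.mem_cons_self]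
    simp

/-! ## §2.3 The two degree-2 e-free words and their cell coefficients -/

/-- the word `h h 1 1`. -/
def wHH : Word := ![Sym.h, Sym.h, Sym.one, Sym.one]
/-- the word `pt 1 1 1`. -/
def wPT : Word := ![Sym.pt, Sym.one, Sym.one, Sym.one]

theorem wHH_efree : wHH.efree := by
  intro f; fin_cases f <;> rfl
theorem wPT_efree : wPT.efree := by
  intro f; fin_cases f <;> rfl
theorem wHH_deg : wHH.deg = 2 := by decide
theorem wPT_deg : wPT.deg = 2 := by decide

theorem cellCoef_wHH (c : Cell) : cellCoef c wHH = ((c 0).a : GaussianInt) * ((c 1).a : GaussianInt) := by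
  unfold cellCoef wHH
  simp [Fin.prod_univ_four, Sym.coef]

theorem cellCoef_wPT (c : Cell) : cellCoef c wPT = ((c 0).selfInt : GaussianInt) := by
  unfold cellCoef wPT
  simp [Fin.prod_univ_four, Sym.coef]

/-! ## §2.4 Letter shapes forced at co-level ≤ 2 -/

/-- an off-axis letter of height 14 and co-level ≤ 2 is `(12; ±1, ±1)`: `a = 12`, `|x| = |y| = 1`. -/
theorem shape_P_letter {ℓ : Letter} (hℓ : ℓ.OnAlphabet 14) (hc : ℓ.colevel ≤ 2) (hx : ℓ.x ≠ 0) (hy : ℓ.y ≠ 0) :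
    ℓ.a = 12 ∧ |ℓ.x| = 1 ∧ |ℓ.y| = 1 := by
  obtain ⟨hh, _⟩ := hℓ
  unfold Letter.height at hh
  unfold Letter.colevel at hc
  have hx1 : 1 ≤ |ℓ.x| := Int.one_le_abs hx
  have hy1 : 1 ≤ |ℓ.y| := Int.one_le_abs hy
  refine ⟨by linarith, by linarith, by linarith⟩

/-- … hence its coefficients: `coef h = 12`, `coef pt = a² − b = 144 − 2 = 142`. -/
theorem selfInt_P_letter {ℓ : Letter} (ha : ℓ.a = 12) (hx : |ℓ.x| = 1) (hy : |ℓ.y| = 1) : ℓ.selfInt = 142 := by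
  unfold Letter.selfInt Letter.bnorm
  have hx2 : ℓ.x ^ 2 = 1 := by nlinarith [sq_abs ℓ.x]
  have hy2 : ℓ.y ^ 2 = 1 := by nlinarith [sq_abs ℓ.y]
  rw [ha, hx2, hy2]; norm_num

/-- a letter of height 14 amply above a `(12; ±1, ±1)` letter is the hub: `a = 14`, `x = y = 0` (STRICT-SHRINK). -/
theorem shape_N_letter {x y : Letter} (hx : x.OnAlphabet 14) (hy : y.OnAlphabet 14) (hxx : |x.x| = 1) (hxy : |x.y| = 1)
    (hA : AmpleAbove x y) : y.a = 14 ∧ y.x = 0 ∧ y.y = 0 := by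
  have hh : x.height = y.height := hx.1.trans hy.1.symm
  obtain ⟨h1, h2⟩ := strict_shrink x y hh hA
  have hyx : |y.x| = 0 := by have := abs_nonneg y.x; omega
  have hyy : |y.y| = 0 := by have := abs_nonneg y.y; omega
  have hyx' : y.x = 0 := abs_eq_zero.mp hyx
  have hyy' : y.y = 0 := abs_eq_zero.mp hyy
  have hh14 := hy.1
  unfold Letter.height at hh14
  rw [hyx', hyy'] at hh14
  simp at hh14
  exact ⟨hh14, hyx', hyy'⟩

/-! ## §2.5 (K1): RING 2 IS EMPTY — as a theorem -/

/-- **(K1) in the kernel** (colour-1 g2 l.8369; pen ×2, machine ×2): `RingsEmpty 14 B rmin 2` for every budget `B` and every rank floor `rmin`. -/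
theorem ringsEmpty_colevel_two (B : ℕ) (rmin : ℤ) : RingsEmpty 14 B rmin 2 := by
  intro D hA h1 h4 hμ _ _ hc
  -- (1) every P-support cell has letters (12; ±1, ±1) on every factor
  have hPshape : ∀ x ∈ D.suppP, ∀ f : Fin 4, (x f).a = 12 ∧ |(x f).x| = 1 ∧ |(x f).y| = 1 := by
    intro x hx f
    obtain ⟨y, hy, hlive⟩ := h4.1 x hx
    have hxA : (x f).OnAlphabet 14 := hA x (List.mem_append.mpr (Or.inr hx)) f
    have hyA : (y f).OnAlphabet 14 := hA y (List.mem_append.mpr (Or.inl hy)) f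
    have hnotaxis : ¬ (x f).isAxis := fun hax =>
      no_ample_cover_of_axis (x f) (y f) (hxA.1.trans hyA.1.symm) hax (hlive f)
    unfold Letter.isAxis at hnotaxis
    have hxx : (x f).x ≠ 0 := fun h0 => hnotaxis (by rw [h0]; ring)
    have hxy : (x f).y ≠ 0 := fun h0 => hnotaxis (by rw [h0]; ring)
    exact shape_P_letter hxA (hc x (List.mem_append.mpr (Or.inr hx)) f) hxx hxy
  -- (2) every N-support cell is the hub cell
  have hNshape : ∀ y ∈ D.suppN, ∀ f : Fin 4, (y f).a = 14 ∧ (y f).x = 0 ∧ (y f).y = 0 := by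
    intro y hy f
    obtain ⟨x, hx, hlive⟩ := h4.2 y hy
    have hxA : (x f).OnAlphabet 14 := hA x (List.mem_append.mpr (Or.inr hx)) f
    have hyA : (y f).OnAlphabet 14 := hA y (List.mem_append.mpr (Or.inl hy)) f
    obtain ⟨_, hxx, hxy⟩ := hPshape x hx f
    exact shape_N_letter hxA hyA hxx hxy (hlive f)
  -- (3) the two degree-2 e-free words have equal tensor coefficient
  have hT : D.T wHH = D.T wPT := h1.2 wHH wPT wHH_efree wPT_efree (wHH_deg.trans wPT_deg.symm)
  -- (4) evaluate both sides: N-part difference 0, P-part difference 2·Σ_P m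
  have hNdiff : (D.N.map fun cm => (cm.2 : GaussianInt) * cellCoef cm.1 wHH).sum -
      (D.N.map fun cm => (cm.2 : GaussianInt) * cellCoef cm.1 wPT).sum = 0 * ((D.N.map Prod.snd).sum : ℕ) := by
    refine wsum_sub_const D.N (fun c => cellCoef c wHH) (fun c => cellCoef c wPT) 0 ?_
    intro cm hcm hpos
    have hmem : cm.1 ∈ D.suppN := (mem_suppN_iff D cm.1).mpr ⟨cm.2, by simpa using hcm, hpos⟩
    obtain ⟨ha0, _, _⟩ := hNshape cm.1 hmem 0
    obtain ⟨ha1, _, _⟩ := hNshape cm.1 hmem 1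
    have hs0 : (cm.1 0).selfInt = 196 := by
      obtain ⟨ha, hx0, hy0⟩ := hNshape cm.1 hmem 0
      unfold Letter.selfInt Letter.bnorm; rw [ha, hx0, hy0]; norm_num
    rw [cellCoef_wHH, cellCoef_wPT, ha0, ha1, hs0]; norm_num
  have hPdiff : (D.P.map fun cm => (cm.2 : GaussianInt) * cellCoef cm.1 wHH).sum -
      (D.P.map fun cm => (cm.2 : GaussianInt) * cellCoef cm.1 wPT).sum = 2 * ((D.P.map Prod.snd).sum : ℕ) := by
    refine wsum_sub_const D.P (fun c => cellCoef c wHH) (fun c => cellCoef c wPT) 2 ?_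
    intro cm hcm hpos
    have hmem : cm.1 ∈ D.suppP := (mem_suppP_iff D cm.1).mpr ⟨cm.2, by simpa using hcm, hpos⟩
    obtain ⟨ha0, hx0, hy0⟩ := hPshape cm.1 hmem 0
    obtain ⟨ha1, _, _⟩ := hPshape cm.1 hmem 1
    rw [cellCoef_wHH, cellCoef_wPT, ha0, ha1, selfInt_P_letter ha0 hx0 hy0]; norm_num
  -- (5) so Σ_P m = 0
  have hTsub : D.T wHH - D.T wPT = 0 := sub_eq_zero.mpr hT
  have hcalc : D.T wHH - D.T wPT = 0 * ((D.N.map Prod.snd).sum : ℕ) - 2 * ((D.P.map Prod.snd).sum : ℕ) := by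
    unfold Design.T
    rw [← hNdiff, ← hPdiff]
    ring
  have hsumP0 : (((D.P.map Prod.snd).sum : ℕ) : GaussianInt) = 0 := by
    have h2 : (2 : GaussianInt) * ((D.P.map Prod.snd).sum : ℕ) = 0 := by
      have := hTsub; rw [hcalc] at this; linear_combination -this
    rcases mul_eq_zero.mp h2 with h20 | hs
    · exact absurd h20 two_ne_zero
    · exact hs
  have hsumP : (D.P.map Prod.snd).sum = 0 := by exact_mod_cast hsumP0
  -- (6) hence every P multiplicity is 0, the P-support is empty, and by (A4) so is the N-support
  have hPzero : ∀ cm ∈ D.P, cm.2 = 0 := by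
    intro cm hcm
    have : cm.2 ∈ D.P.map Prod.snd := List.mem_map.mpr ⟨cm, hcm, rfl⟩
    exact (List.sum_eq_zero_iff_forall_eq_nat.mp hsumP) _ this
  have hsuppP : D.suppP = [] := by
    apply List.eq_nil_iff_forall_not_mem.mpr
    intro c hc
    obtain ⟨m, hm, hpos⟩ := (mem_suppP_iff D c).mp hc
    have := hPzero (c, m) hm
    simp at this; omega
  have hNzero : ∀ cm ∈ D.N, cm.2 = 0 := by
    intro cm hcm
    by_contra hne
    have hpos : 0 < cm.2 := Nat.pos_of_ne_zero hne
    have hmem : cm.1 ∈ D.suppN := (mem_suppN_iff D cm.1).mpr ⟨cm.2, by simpa using hcm, hpos⟩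
    obtain ⟨x, hx, _⟩ := h4.2 cm.1 hmem
    rw [hsuppP] at hx
    simp at hx
  -- (7) μ = 0: contradiction
  apply hμ
  have hN0 : (D.N.map fun cm => (cm.2 : GaussianInt) * cellCoef cm.1 Word.eeee).sum = 0 :=
    wsum_eq_zero_of_mults_zero D.N (fun c => cellCoef c Word.eeee) hNzero
  have hP0 : (D.P.map fun cm => (cm.2 : GaussianInt) * cellCoef cm.1 Word.eeee).sum = 0 :=
    wsum_eq_zero_of_mults_zero D.P (fun c => cellCoef c Word.eeee) hPzero
  unfold Design.mu Design.T
  rw [hN0, hP0]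
  simp

end prover_s4search1

/-- Leg A below ring 3, assembled: the conjecture of record at `c₀ = 2` would close the (A4) road outright (ring 2 is a theorem). -/
theorem a4_closed_below_ring3_of_depthBound_two (hd : DepthBound 14 199 8 2) :
    ∀ D : Design, D.OnAlphabet 14 → D.A1 → D.A4 → D.mu ≠ 0 → D.copies ≤ 199 → 8 ≤ D.rank → False :=
  a4_closed_of_depthBound_and_rings 14 199 8 2 hd (ringsEmpty_colevel_two 199 8)

/-! ## RING 3 IS EMPTY — kernel theorem (strengthen g6; functional of hsemireg-monad-1 g4, bus l.8464, recomputed ×2 by idea-crit-6 l.8500)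
On the height-14 alphabet with all P-letters of co-level ≤ 3: (A4) ⇒ P-letters are off-axis (`no_ample_cover_of_axis`), so
`(a, a² − b) ∈ {(12,142), (11,116)}`; N-letters have co-level ≤ 1 (`colevel_drop_two`), so `(a, a² − b) ∈ {(14,196), (13,168)}`.
monad-1's degree-2∕3 functional `24F = 75 Σ_f n_f − 50 e₂(a) − 2 Σ_{f≠g} n_f a_g + 6 e₃(a)` (`n = a² − b` the `pt`-coefficient)
satisfies `24F ≤ −24` on every P-type cell and `24F ≥ 0` on every N-type cell (2⁴ + 2⁴ sign cases, `norm_num`), while the (A1)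
e-free rows of degrees 2 and 3 give `Σ_N m·24F − Σ_P m·24F = (75·4 − 50·6)c₂ + (−2·12 + 6·4)c₃ = 0`; hence `Σ_P m = 0`, the supports
are empty and `μ = 0`.  No cell enumeration, no `native_decide`.  Valid for every budget `B` and rank floor `rmin`. -/

section ring3

/-- Integer coefficient of an e-free symbol (`e, ē ↦ 0`, unused). -/
def Sym.icoef : Sym → Letter → ℤ
  | Sym.one, _ => 1
  | Sym.h, ℓ => ℓ.a
  | Sym.pt, ℓ => ℓ.selfInt
  | Sym.e, _ => 0
  | Sym.ebar, _ => 0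

/-- Integer cell coefficient of a word. -/
def icellCoef (c : Cell) (w : Word) : ℤ := ∏ f : Fin 4, (w f).icoef (c f)

theorem coef_eq_cast_icoef (s : Sym) (ℓ : Letter) (hs : s.efree = true) : s.coef ℓ = ((s.icoef ℓ : ℤ) : GaussianInt) := by
  cases s <;> simp [Sym.efree] at hs <;> simp [Sym.coef, Sym.icoef]

theorem cellCoef_eq_cast (c : Cell) (w : Word) (hw : w.efree) : cellCoef c w = ((icellCoef c w : ℤ) : GaussianInt) := by
  unfold cellCoef icellCoef
  rw [Int.cast_prod]
  exact Finset.prod_congr rfl fun f _ => coef_eq_cast_icoef (w f) (c f) (hw f)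

/-- Weighted integer sum over a list of (cell, multiplicity) entries. -/
def linZ (L : List (Cell × ℕ)) (φ : Cell → ℤ) : ℤ := (L.map fun cm => (cm.2 : ℤ) * φ cm.1).sum

theorem linZ_nil (φ : Cell → ℤ) : linZ [] φ = 0 := by simp [linZ]

theorem linZ_cons (a : Cell × ℕ) (t : List (Cell × ℕ)) (φ : Cell → ℤ) :
    linZ (a :: t) φ = (a.2 : ℤ) * φ a.1 + linZ t φ := by simp [linZ]

theorem linZ_cast (L : List (Cell × ℕ)) (φ : Cell → ℤ) :
    ((linZ L φ : ℤ) : GaussianInt) = (L.map fun cm => (cm.2 : GaussianInt) * ((φ cm.1 : ℤ) : GaussianInt)).sum := by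
  induction L with
  | nil => simp [linZ]
  | cons a t ih => rw [linZ_cons, List.map_cons, List.sum_cons, ← ih]; push_cast; ring

/-- The integer class tensor on a word. -/
def Design.Tz (D : Design) (w : Word) : ℤ := linZ D.N (fun c => icellCoef c w) - linZ D.P (fun c => icellCoef c w)

theorem T_eq_cast_Tz (D : Design) (w : Word) (hw : w.efree) : D.T w = ((D.Tz w : ℤ) : GaussianInt) := by
  unfold Design.T Design.Tz
  rw [Int.cast_sub, linZ_cast, linZ_cast]
  simp_rw [cellCoef_eq_cast _ _ hw]

/-- (A1), integer form: e-free words of equal degree have equal integer tensor coefficient. -/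
theorem Tz_eq_of_A1 (D : Design) (h1 : D.A1) (w w' : Word) (hw : w.efree) (hw' : w'.efree) (hd : w.deg = w'.deg) :
    D.Tz w = D.Tz w' := by
  have h := h1.2 w w' hw hw' hd
  rw [T_eq_cast_Tz D w hw, T_eq_cast_Tz D w' hw'] at h
  exact_mod_cast h

theorem linZ_nonneg (L : List (Cell × ℕ)) (φ : Cell → ℤ) (h : ∀ cm ∈ L, 0 < cm.2 → 0 ≤ φ cm.1) : 0 ≤ linZ L φ := by
  induction L with
  | nil => simp [linZ]
  | cons a t ih =>
    rw [linZ_cons]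
    have ht : 0 ≤ linZ t φ := ih fun cm hcm => h cm (List.mem_cons_of_mem _ hcm)
    rcases Nat.eq_zero_or_pos a.2 with h0 | hpos
    · rw [h0, Nat.cast_zero, zero_mul]
      linarith
    · have ha : 0 ≤ φ a.1 := h a List.mem_cons_self hpos
      have hm : (0 : ℤ) ≤ (a.2 : ℤ) := by exact_mod_cast Nat.zero_le _
      have hprod : (0 : ℤ) ≤ (a.2 : ℤ) * φ a.1 := mul_nonneg hm ha
      linarith

theorem linZ_le_mul_sum (L : List (Cell × ℕ)) (φ : Cell → ℤ) (b : ℤ) (h : ∀ cm ∈ L, 0 < cm.2 → φ cm.1 ≤ b) :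
    linZ L φ ≤ b * ((L.map Prod.snd).sum : ℕ) := by
  induction L with
  | nil => simp [linZ]
  | cons a t ih =>
    rw [linZ_cons, List.map_cons, List.sum_cons, Nat.cast_add, mul_add]
    have ht := ih fun cm hcm => h cm (List.mem_cons_of_mem _ hcm)
    rcases Nat.eq_zero_or_pos a.2 with h0 | hpos
    · rw [h0, Nat.cast_zero, zero_mul, mul_zero]
      linarith
    · have ha : φ a.1 ≤ b := h a List.mem_cons_self hpos
      have hm : (0 : ℤ) ≤ (a.2 : ℤ) := by exact_mod_cast Nat.zero_le _
      have hprod : (a.2 : ℤ) * φ a.1 ≤ (a.2 : ℤ) * b := mul_le_mul_of_nonneg_left ha hm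
      linarith

/-! ### The 26 e-free words of degrees 2 and 3 -/

/-- `p111` -/
def w3P0 : Word := ![Sym.pt, Sym.one, Sym.one, Sym.one]
/-- `1p11` -/
def w3P1 : Word := ![Sym.one, Sym.pt, Sym.one, Sym.one]
/-- `11p1` -/
def w3P2 : Word := ![Sym.one, Sym.one, Sym.pt, Sym.one]
/-- `111p` -/
def w3P3 : Word := ![Sym.one, Sym.one, Sym.one, Sym.pt]
/-- `hh11` -/
def w3H01 : Word := ![Sym.h, Sym.h, Sym.one, Sym.one]
/-- `h1h1` -/
def w3H02 : Word := ![Sym.h, Sym.one, Sym.h, Sym.one]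
/-- `h11h` -/
def w3H03 : Word := ![Sym.h, Sym.one, Sym.one, Sym.h]
/-- `1hh1` -/
def w3H12 : Word := ![Sym.one, Sym.h, Sym.h, Sym.one]
/-- `1h1h` -/
def w3H13 : Word := ![Sym.one, Sym.h, Sym.one, Sym.h]
/-- `11hh` -/
def w3H23 : Word := ![Sym.one, Sym.one, Sym.h, Sym.h]
/-- `ph11` -/
def w3PH01 : Word := ![Sym.pt, Sym.h, Sym.one, Sym.one]
/-- `p1h1` -/
def w3PH02 : Word := ![Sym.pt, Sym.one, Sym.h, Sym.one]
/-- `p11h` -/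
def w3PH03 : Word := ![Sym.pt, Sym.one, Sym.one, Sym.h]
/-- `hp11` -/
def w3PH10 : Word := ![Sym.h, Sym.pt, Sym.one, Sym.one]
/-- `1ph1` -/
def w3PH12 : Word := ![Sym.one, Sym.pt, Sym.h, Sym.one]
/-- `1p1h` -/
def w3PH13 : Word := ![Sym.one, Sym.pt, Sym.one, Sym.h]
/-- `h1p1` -/
def w3PH20 : Word := ![Sym.h, Sym.one, Sym.pt, Sym.one]
/-- `1hp1` -/
def w3PH21 : Word := ![Sym.one, Sym.h, Sym.pt, Sym.one]
/-- `11ph` -/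
def w3PH23 : Word := ![Sym.one, Sym.one, Sym.pt, Sym.h]
/-- `h11p` -/
def w3PH30 : Word := ![Sym.h, Sym.one, Sym.one, Sym.pt]
/-- `1h1p` -/
def w3PH31 : Word := ![Sym.one, Sym.h, Sym.one, Sym.pt]
/-- `11hp` -/
def w3PH32 : Word := ![Sym.one, Sym.one, Sym.h, Sym.pt]
/-- `1hhh` -/
def w3T0 : Word := ![Sym.one, Sym.h, Sym.h, Sym.h]
/-- `h1hh` -/
def w3T1 : Word := ![Sym.h, Sym.one, Sym.h, Sym.h]
/-- `hh1h` -/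
def w3T2 : Word := ![Sym.h, Sym.h, Sym.one, Sym.h]
/-- `hhh1` -/
def w3T3 : Word := ![Sym.h, Sym.h, Sym.h, Sym.one]

theorem w3P0_efree : w3P0.efree := by intro f; fin_cases f <;> rfl
theorem w3P0_deg : w3P0.deg = 2 := by decide
theorem icellCoef_w3P0 (c : Cell) : icellCoef c w3P0 = (c 0).selfInt := by
  unfold icellCoef w3P0; simp [Fin.prod_univ_four, Sym.icoef]
theorem w3P1_efree : w3P1.efree := by intro f; fin_cases f <;> rfl
theorem w3P1_deg : w3P1.deg = 2 := by decide
theorem icellCoef_w3P1 (c : Cell) : icellCoef c w3P1 = (c 1).selfInt := by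
  unfold icellCoef w3P1; simp [Fin.prod_univ_four, Sym.icoef]
theorem w3P2_efree : w3P2.efree := by intro f; fin_cases f <;> rfl
theorem w3P2_deg : w3P2.deg = 2 := by decide
theorem icellCoef_w3P2 (c : Cell) : icellCoef c w3P2 = (c 2).selfInt := by
  unfold icellCoef w3P2; simp [Fin.prod_univ_four, Sym.icoef]
theorem w3P3_efree : w3P3.efree := by intro f; fin_cases f <;> rfl
theorem w3P3_deg : w3P3.deg = 2 := by decide
theorem icellCoef_w3P3 (c : Cell) : icellCoef c w3P3 = (c 3).selfInt := by
  unfold icellCoef w3P3; simp [Fin.prod_univ_four, Sym.icoef]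
theorem w3H01_efree : w3H01.efree := by intro f; fin_cases f <;> rfl
theorem w3H01_deg : w3H01.deg = 2 := by decide
theorem icellCoef_w3H01 (c : Cell) : icellCoef c w3H01 = (c 0).a * (c 1).a := by
  unfold icellCoef w3H01; simp [Fin.prod_univ_four, Sym.icoef]
theorem w3H02_efree : w3H02.efree := by intro f; fin_cases f <;> rfl
theorem w3H02_deg : w3H02.deg = 2 := by decide
theorem icellCoef_w3H02 (c : Cell) : icellCoef c w3H02 = (c 0).a * (c 2).a := by
  unfold icellCoef w3H02; simp [Fin.prod_univ_four, Sym.icoef]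
theorem w3H03_efree : w3H03.efree := by intro f; fin_cases f <;> rfl
theorem w3H03_deg : w3H03.deg = 2 := by decide
theorem icellCoef_w3H03 (c : Cell) : icellCoef c w3H03 = (c 0).a * (c 3).a := by
  unfold icellCoef w3H03; simp [Fin.prod_univ_four, Sym.icoef]
theorem w3H12_efree : w3H12.efree := by intro f; fin_cases f <;> rfl
theorem w3H12_deg : w3H12.deg = 2 := by decide
theorem icellCoef_w3H12 (c : Cell) : icellCoef c w3H12 = (c 1).a * (c 2).a := by
  unfold icellCoef w3H12; simp [Fin.prod_univ_four, Sym.icoef]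
theorem w3H13_efree : w3H13.efree := by intro f; fin_cases f <;> rfl
theorem w3H13_deg : w3H13.deg = 2 := by decide
theorem icellCoef_w3H13 (c : Cell) : icellCoef c w3H13 = (c 1).a * (c 3).a := by
  unfold icellCoef w3H13; simp [Fin.prod_univ_four, Sym.icoef]
theorem w3H23_efree : w3H23.efree := by intro f; fin_cases f <;> rfl
theorem w3H23_deg : w3H23.deg = 2 := by decide
theorem icellCoef_w3H23 (c : Cell) : icellCoef c w3H23 = (c 2).a * (c 3).a := by
  unfold icellCoef w3H23; simp [Fin.prod_univ_four, Sym.icoef]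
theorem w3PH01_efree : w3PH01.efree := by intro f; fin_cases f <;> rfl
theorem w3PH01_deg : w3PH01.deg = 3 := by decide
theorem icellCoef_w3PH01 (c : Cell) : icellCoef c w3PH01 = (c 0).selfInt * (c 1).a := by
  unfold icellCoef w3PH01; simp [Fin.prod_univ_four, Sym.icoef]
theorem w3PH02_efree : w3PH02.efree := by intro f; fin_cases f <;> rfl
theorem w3PH02_deg : w3PH02.deg = 3 := by decide
theorem icellCoef_w3PH02 (c : Cell) : icellCoef c w3PH02 = (c 0).selfInt * (c 2).a := by
  unfold icellCoef w3PH02; simp [Fin.prod_univ_four, Sym.icoef]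
theorem w3PH03_efree : w3PH03.efree := by intro f; fin_cases f <;> rfl
theorem w3PH03_deg : w3PH03.deg = 3 := by decide
theorem icellCoef_w3PH03 (c : Cell) : icellCoef c w3PH03 = (c 0).selfInt * (c 3).a := by
  unfold icellCoef w3PH03; simp [Fin.prod_univ_four, Sym.icoef]
theorem w3PH10_efree : w3PH10.efree := by intro f; fin_cases f <;> rfl
theorem w3PH10_deg : w3PH10.deg = 3 := by decide
theorem icellCoef_w3PH10 (c : Cell) : icellCoef c w3PH10 = (c 0).a * (c 1).selfInt := by
  unfold icellCoef w3PH10; simp [Fin.prod_univ_four, Sym.icoef]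
theorem w3PH12_efree : w3PH12.efree := by intro f; fin_cases f <;> rfl
theorem w3PH12_deg : w3PH12.deg = 3 := by decide
theorem icellCoef_w3PH12 (c : Cell) : icellCoef c w3PH12 = (c 1).selfInt * (c 2).a := by
  unfold icellCoef w3PH12; simp [Fin.prod_univ_four, Sym.icoef]
theorem w3PH13_efree : w3PH13.efree := by intro f; fin_cases f <;> rfl
theorem w3PH13_deg : w3PH13.deg = 3 := by decide
theorem icellCoef_w3PH13 (c : Cell) : icellCoef c w3PH13 = (c 1).selfInt * (c 3).a := by
  unfold icellCoef w3PH13; simp [Fin.prod_univ_four, Sym.icoef]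
theorem w3PH20_efree : w3PH20.efree := by intro f; fin_cases f <;> rfl
theorem w3PH20_deg : w3PH20.deg = 3 := by decide
theorem icellCoef_w3PH20 (c : Cell) : icellCoef c w3PH20 = (c 0).a * (c 2).selfInt := by
  unfold icellCoef w3PH20; simp [Fin.prod_univ_four, Sym.icoef]
theorem w3PH21_efree : w3PH21.efree := by intro f; fin_cases f <;> rfl
theorem w3PH21_deg : w3PH21.deg = 3 := by decide
theorem icellCoef_w3PH21 (c : Cell) : icellCoef c w3PH21 = (c 1).a * (c 2).selfInt := by
  unfold icellCoef w3PH21; simp [Fin.prod_univ_four, Sym.icoef]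
theorem w3PH23_efree : w3PH23.efree := by intro f; fin_cases f <;> rfl
theorem w3PH23_deg : w3PH23.deg = 3 := by decide
theorem icellCoef_w3PH23 (c : Cell) : icellCoef c w3PH23 = (c 2).selfInt * (c 3).a := by
  unfold icellCoef w3PH23; simp [Fin.prod_univ_four, Sym.icoef]
theorem w3PH30_efree : w3PH30.efree := by intro f; fin_cases f <;> rfl
theorem w3PH30_deg : w3PH30.deg = 3 := by decide
theorem icellCoef_w3PH30 (c : Cell) : icellCoef c w3PH30 = (c 0).a * (c 3).selfInt := by
  unfold icellCoef w3PH30; simp [Fin.prod_univ_four, Sym.icoef]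
theorem w3PH31_efree : w3PH31.efree := by intro f; fin_cases f <;> rfl
theorem w3PH31_deg : w3PH31.deg = 3 := by decide
theorem icellCoef_w3PH31 (c : Cell) : icellCoef c w3PH31 = (c 1).a * (c 3).selfInt := by
  unfold icellCoef w3PH31; simp [Fin.prod_univ_four, Sym.icoef]
theorem w3PH32_efree : w3PH32.efree := by intro f; fin_cases f <;> rfl
theorem w3PH32_deg : w3PH32.deg = 3 := by decide
theorem icellCoef_w3PH32 (c : Cell) : icellCoef c w3PH32 = (c 2).a * (c 3).selfInt := by
  unfold icellCoef w3PH32; simp [Fin.prod_univ_four, Sym.icoef]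
theorem w3T0_efree : w3T0.efree := by intro f; fin_cases f <;> rfl
theorem w3T0_deg : w3T0.deg = 3 := by decide
theorem icellCoef_w3T0 (c : Cell) : icellCoef c w3T0 = (c 1).a * (c 2).a * (c 3).a := by
  unfold icellCoef w3T0; simp [Fin.prod_univ_four, Sym.icoef]
theorem w3T1_efree : w3T1.efree := by intro f; fin_cases f <;> rfl
theorem w3T1_deg : w3T1.deg = 3 := by decide
theorem icellCoef_w3T1 (c : Cell) : icellCoef c w3T1 = (c 0).a * (c 2).a * (c 3).a := by
  unfold icellCoef w3T1; simp [Fin.prod_univ_four, Sym.icoef]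
theorem w3T2_efree : w3T2.efree := by intro f; fin_cases f <;> rfl
theorem w3T2_deg : w3T2.deg = 3 := by decide
theorem icellCoef_w3T2 (c : Cell) : icellCoef c w3T2 = (c 0).a * (c 1).a * (c 3).a := by
  unfold icellCoef w3T2; simp [Fin.prod_univ_four, Sym.icoef]
theorem w3T3_efree : w3T3.efree := by intro f; fin_cases f <;> rfl
theorem w3T3_deg : w3T3.deg = 3 := by decide
theorem icellCoef_w3T3 (c : Cell) : icellCoef c w3T3 = (c 0).a * (c 1).a * (c 2).a := by
  unfold icellCoef w3T3; simp [Fin.prod_univ_four, Sym.icoef]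

/-! ### monad-1's functional -/

/-- `24F` as a polynomial in the four levels `aᵢ` and the four `pt`-coefficients `nᵢ = aᵢ² − bᵢ`. -/
def F24poly (a0 n0 a1 n1 a2 n2 a3 n3 : ℤ) : ℤ :=
  75 * (n0 + n1 + n2 + n3)
  - 50 * (a0 * a1 + a0 * a2 + a0 * a3 + a1 * a2 + a1 * a3 + a2 * a3)
  - 2 * (n0 * a1 + n0 * a2 + n0 * a3 + n1 * a0 + n1 * a2 + n1 * a3 + n2 * a0 + n2 * a1 + n2 * a3 + n3 * a0 + n3 * a1 + n3 * a2)
  + 6 * (a1 * a2 * a3 + a0 * a2 * a3 + a0 * a1 * a3 + a0 * a1 * a2)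

/-- `24F` of a cell. -/
def F24 (c : Cell) : ℤ :=
  F24poly (c 0).a (c 0).selfInt (c 1).a (c 1).selfInt (c 2).a (c 2).selfInt (c 3).a (c 3).selfInt

/-- P-TYPE letter: `(a, a² − b) ∈ {(12, 142), (11, 116)}` (off-axis, height 14, co-level ≤ 3). -/
def PType (ℓ : Letter) : Prop := (ℓ.a = 12 ∧ ℓ.selfInt = 142) ∨ (ℓ.a = 11 ∧ ℓ.selfInt = 116)

/-- N-TYPE letter: `(a, a² − b) ∈ {(14, 196), (13, 168)}` (height 14, co-level ≤ 1). -/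
def NType (ℓ : Letter) : Prop := (ℓ.a = 14 ∧ ℓ.selfInt = 196) ∨ (ℓ.a = 13 ∧ ℓ.selfInt = 168)

theorem F24poly_P_le (a0 n0 a1 n1 a2 n2 a3 n3 : ℤ)
    (h0 : (a0 = 12 ∧ n0 = 142) ∨ (a0 = 11 ∧ n0 = 116)) (h1 : (a1 = 12 ∧ n1 = 142) ∨ (a1 = 11 ∧ n1 = 116))
    (h2 : (a2 = 12 ∧ n2 = 142) ∨ (a2 = 11 ∧ n2 = 116)) (h3 : (a3 = 12 ∧ n3 = 142) ∨ (a3 = 11 ∧ n3 = 116)) :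
    F24poly a0 n0 a1 n1 a2 n2 a3 n3 ≤ -24 := by
  rcases h0 with ⟨rfl, rfl⟩ | ⟨rfl, rfl⟩ <;> rcases h1 with ⟨rfl, rfl⟩ | ⟨rfl, rfl⟩ <;>
    rcases h2 with ⟨rfl, rfl⟩ | ⟨rfl, rfl⟩ <;> rcases h3 with ⟨rfl, rfl⟩ | ⟨rfl, rfl⟩ <;> norm_num [F24poly]

theorem F24poly_N_nonneg (a0 n0 a1 n1 a2 n2 a3 n3 : ℤ)
    (h0 : (a0 = 14 ∧ n0 = 196) ∨ (a0 = 13 ∧ n0 = 168)) (h1 : (a1 = 14 ∧ n1 = 196) ∨ (a1 = 13 ∧ n1 = 168))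
    (h2 : (a2 = 14 ∧ n2 = 196) ∨ (a2 = 13 ∧ n2 = 168)) (h3 : (a3 = 14 ∧ n3 = 196) ∨ (a3 = 13 ∧ n3 = 168)) :
    0 ≤ F24poly a0 n0 a1 n1 a2 n2 a3 n3 := by
  rcases h0 with ⟨rfl, rfl⟩ | ⟨rfl, rfl⟩ <;> rcases h1 with ⟨rfl, rfl⟩ | ⟨rfl, rfl⟩ <;>
    rcases h2 with ⟨rfl, rfl⟩ | ⟨rfl, rfl⟩ <;> rcases h3 with ⟨rfl, rfl⟩ | ⟨rfl, rfl⟩ <;> norm_num [F24poly]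

theorem F24_P_le (c : Cell) (h : ∀ f : Fin 4, PType (c f)) : F24 c ≤ -24 :=
  F24poly_P_le _ _ _ _ _ _ _ _ (h 0) (h 1) (h 2) (h 3)

theorem F24_N_nonneg (c : Cell) (h : ∀ f : Fin 4, NType (c f)) : 0 ≤ F24 c :=
  F24poly_N_nonneg _ _ _ _ _ _ _ _ (h 0) (h 1) (h 2) (h 3)

/-! ### Letter shapes at co-level ≤ 3 (P) and ≤ 1 (N) -/

theorem pType_of {ℓ : Letter} (hℓ : ℓ.OnAlphabet 14) (hc : ℓ.colevel ≤ 3) (hx : ℓ.x ≠ 0) (hy : ℓ.y ≠ 0) : PType ℓ := by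
  obtain ⟨hh, _⟩ := hℓ
  unfold Letter.height at hh
  unfold Letter.colevel at hc
  have hx1 : 1 ≤ |ℓ.x| := Int.one_le_abs hx
  have hy1 : 1 ≤ |ℓ.y| := Int.one_le_abs hy
  have hx2 : ℓ.x ^ 2 = |ℓ.x| ^ 2 := (sq_abs ℓ.x).symm
  have hy2 : ℓ.y ^ 2 = |ℓ.y| ^ 2 := (sq_abs ℓ.y).symm
  unfold PType Letter.selfInt Letter.bnorm
  rw [hx2, hy2]
  rcases (show |ℓ.x| = 1 ∨ |ℓ.x| = 2 by omega) with hu | hu <;>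
    rcases (show |ℓ.y| = 1 ∨ |ℓ.y| = 2 by omega) with hv | hv
  · left; refine ⟨by omega, ?_⟩; rw [hu, hv, show ℓ.a = 12 by omega]; norm_num
  · right; refine ⟨by omega, ?_⟩; rw [hu, hv, show ℓ.a = 11 by omega]; norm_num
  · right; refine ⟨by omega, ?_⟩; rw [hu, hv, show ℓ.a = 11 by omega]; norm_num
  · exfalso; omega

theorem nType_of {ℓ : Letter} (hℓ : ℓ.OnAlphabet 14) (hc : ℓ.colevel ≤ 1) : NType ℓ := by
  obtain ⟨hh, _⟩ := hℓ
  unfold Letter.height at hh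
  unfold Letter.colevel at hc
  have hx0 := abs_nonneg ℓ.x
  have hy0 := abs_nonneg ℓ.y
  have hx2 : ℓ.x ^ 2 = |ℓ.x| ^ 2 := (sq_abs ℓ.x).symm
  have hy2 : ℓ.y ^ 2 = |ℓ.y| ^ 2 := (sq_abs ℓ.y).symm
  unfold NType Letter.selfInt Letter.bnorm
  rw [hx2, hy2]
  rcases (show (|ℓ.x| = 0 ∧ |ℓ.y| = 0) ∨ (|ℓ.x| = 1 ∧ |ℓ.y| = 0) ∨ (|ℓ.x| = 0 ∧ |ℓ.y| = 1) by omega) with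
    ⟨hu, hv⟩ | ⟨hu, hv⟩ | ⟨hu, hv⟩
  · left; refine ⟨by omega, ?_⟩; rw [hu, hv, show ℓ.a = 14 by omega]; norm_num
  · right; refine ⟨by omega, ?_⟩; rw [hu, hv, show ℓ.a = 13 by omega]; norm_num
  · right; refine ⟨by omega, ?_⟩; rw [hu, hv, show ℓ.a = 13 by omega]; norm_num

/-! ### The functional as a combination of word coefficients, and its (A1)-vanishing -/

/-- group sums of integer word coefficients -/
def S1 (c : Cell) : ℤ := icellCoef c w3P0 + icellCoef c w3P1 + icellCoef c w3P2 + icellCoef c w3P3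
/-- `e₂(a)` -/
def S2 (c : Cell) : ℤ :=
  icellCoef c w3H01 + icellCoef c w3H02 + icellCoef c w3H03 + icellCoef c w3H12 + icellCoef c w3H13 + icellCoef c w3H23
/-- `Σ_{f ≠ g} n_f a_g` -/
def S3 (c : Cell) : ℤ :=
  icellCoef c w3PH01 + icellCoef c w3PH02 + icellCoef c w3PH03 + icellCoef c w3PH10 + icellCoef c w3PH12 + icellCoef c w3PH13
  + icellCoef c w3PH20 + icellCoef c w3PH21 + icellCoef c w3PH23 + icellCoef c w3PH30 + icellCoef c w3PH31 + icellCoef c w3PH32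
/-- `6 e₃(a) / 6` -/
def S4 (c : Cell) : ℤ := icellCoef c w3T0 + icellCoef c w3T1 + icellCoef c w3T2 + icellCoef c w3T3

theorem F24_cell (c : Cell) : F24 c = 75 * S1 c - 50 * S2 c - 2 * S3 c + 6 * S4 c := by
  simp only [S1, S2, S3, S4, icellCoef_w3P0, icellCoef_w3P1, icellCoef_w3P2, icellCoef_w3P3,
    icellCoef_w3H01, icellCoef_w3H02, icellCoef_w3H03, icellCoef_w3H12, icellCoef_w3H13, icellCoef_w3H23,
    icellCoef_w3PH01, icellCoef_w3PH02, icellCoef_w3PH03, icellCoef_w3PH10, icellCoef_w3PH12, icellCoef_w3PH13,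
    icellCoef_w3PH20, icellCoef_w3PH21, icellCoef_w3PH23, icellCoef_w3PH30, icellCoef_w3PH31, icellCoef_w3PH32,
    icellCoef_w3T0, icellCoef_w3T1, icellCoef_w3T2, icellCoef_w3T3]
  unfold F24 F24poly
  ring

theorem linZ_F24 (L : List (Cell × ℕ)) :
    linZ L F24 = 75 * linZ L S1 - 50 * linZ L S2 - 2 * linZ L S3 + 6 * linZ L S4 := by
  induction L with
  | nil => simp [linZ]
  | cons a t ih => simp only [linZ_cons]; rw [ih, F24_cell]; ring

theorem linZ_S1 (L : List (Cell × ℕ)) : linZ L S1 =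
    linZ L (fun c => icellCoef c w3P0) + linZ L (fun c => icellCoef c w3P1) + linZ L (fun c => icellCoef c w3P2)
    + linZ L (fun c => icellCoef c w3P3) := by
  induction L with
  | nil => simp [linZ]
  | cons a t ih => simp only [linZ_cons]; rw [ih, S1]; ring

theorem linZ_S2 (L : List (Cell × ℕ)) : linZ L S2 =
    linZ L (fun c => icellCoef c w3H01) + linZ L (fun c => icellCoef c w3H02) + linZ L (fun c => icellCoef c w3H03)
    + linZ L (fun c => icellCoef c w3H12) + linZ L (fun c => icellCoef c w3H13) + linZ L (fun c => icellCoef c w3H23) := by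
  induction L with
  | nil => simp [linZ]
  | cons a t ih => simp only [linZ_cons]; rw [ih, S2]; ring

theorem linZ_S3 (L : List (Cell × ℕ)) : linZ L S3 =
    linZ L (fun c => icellCoef c w3PH01) + linZ L (fun c => icellCoef c w3PH02) + linZ L (fun c => icellCoef c w3PH03)
    + linZ L (fun c => icellCoef c w3PH10) + linZ L (fun c => icellCoef c w3PH12) + linZ L (fun c => icellCoef c w3PH13)
    + linZ L (fun c => icellCoef c w3PH20) + linZ L (fun c => icellCoef c w3PH21) + linZ L (fun c => icellCoef c w3PH23)
    + linZ L (fun c => icellCoef c w3PH30) + linZ L (fun c => icellCoef c w3PH31) + linZ L (fun c => icellCoef c w3PH32) := by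
  induction L with
  | nil => simp [linZ]
  | cons a t ih => simp only [linZ_cons]; rw [ih, S3]; ring

theorem linZ_S4 (L : List (Cell × ℕ)) : linZ L S4 =
    linZ L (fun c => icellCoef c w3T0) + linZ L (fun c => icellCoef c w3T1) + linZ L (fun c => icellCoef c w3T2)
    + linZ L (fun c => icellCoef c w3T3) := by
  induction L with
  | nil => simp [linZ]
  | cons a t ih => simp only [linZ_cons]; rw [ih, S4]; ring

/-- The (A1) rows of degrees 2 and 3 kill the functional: `Σ_N m·24F − Σ_P m·24F = 0`. -/
theorem functional_vanishes (D : Design) (h1 : D.A1) : linZ D.N F24 - linZ D.P F24 = 0 := by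
  -- degree 2: all ten words have the same integer tensor coefficient as `w3P0`
  have e2P1 := Tz_eq_of_A1 D h1 w3P1 w3P0 w3P1_efree w3P0_efree (w3P1_deg.trans w3P0_deg.symm)
  have e2P2 := Tz_eq_of_A1 D h1 w3P2 w3P0 w3P2_efree w3P0_efree (w3P2_deg.trans w3P0_deg.symm)
  have e2P3 := Tz_eq_of_A1 D h1 w3P3 w3P0 w3P3_efree w3P0_efree (w3P3_deg.trans w3P0_deg.symm)
  have e2H01 := Tz_eq_of_A1 D h1 w3H01 w3P0 w3H01_efree w3P0_efree (w3H01_deg.trans w3P0_deg.symm)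
  have e2H02 := Tz_eq_of_A1 D h1 w3H02 w3P0 w3H02_efree w3P0_efree (w3H02_deg.trans w3P0_deg.symm)
  have e2H03 := Tz_eq_of_A1 D h1 w3H03 w3P0 w3H03_efree w3P0_efree (w3H03_deg.trans w3P0_deg.symm)
  have e2H12 := Tz_eq_of_A1 D h1 w3H12 w3P0 w3H12_efree w3P0_efree (w3H12_deg.trans w3P0_deg.symm)
  have e2H13 := Tz_eq_of_A1 D h1 w3H13 w3P0 w3H13_efree w3P0_efree (w3H13_deg.trans w3P0_deg.symm)
  have e2H23 := Tz_eq_of_A1 D h1 w3H23 w3P0 w3H23_efree w3P0_efree (w3H23_deg.trans w3P0_deg.symm)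
  -- degree 3: all sixteen words have the same integer tensor coefficient as `w3T0`
  have e3PH01 := Tz_eq_of_A1 D h1 w3PH01 w3T0 w3PH01_efree w3T0_efree (w3PH01_deg.trans w3T0_deg.symm)
  have e3PH02 := Tz_eq_of_A1 D h1 w3PH02 w3T0 w3PH02_efree w3T0_efree (w3PH02_deg.trans w3T0_deg.symm)
  have e3PH03 := Tz_eq_of_A1 D h1 w3PH03 w3T0 w3PH03_efree w3T0_efree (w3PH03_deg.trans w3T0_deg.symm)
  have e3PH10 := Tz_eq_of_A1 D h1 w3PH10 w3T0 w3PH10_efree w3T0_efree (w3PH10_deg.trans w3T0_deg.symm)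
  have e3PH12 := Tz_eq_of_A1 D h1 w3PH12 w3T0 w3PH12_efree w3T0_efree (w3PH12_deg.trans w3T0_deg.symm)
  have e3PH13 := Tz_eq_of_A1 D h1 w3PH13 w3T0 w3PH13_efree w3T0_efree (w3PH13_deg.trans w3T0_deg.symm)
  have e3PH20 := Tz_eq_of_A1 D h1 w3PH20 w3T0 w3PH20_efree w3T0_efree (w3PH20_deg.trans w3T0_deg.symm)
  have e3PH21 := Tz_eq_of_A1 D h1 w3PH21 w3T0 w3PH21_efree w3T0_efree (w3PH21_deg.trans w3T0_deg.symm)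
  have e3PH23 := Tz_eq_of_A1 D h1 w3PH23 w3T0 w3PH23_efree w3T0_efree (w3PH23_deg.trans w3T0_deg.symm)
  have e3PH30 := Tz_eq_of_A1 D h1 w3PH30 w3T0 w3PH30_efree w3T0_efree (w3PH30_deg.trans w3T0_deg.symm)
  have e3PH31 := Tz_eq_of_A1 D h1 w3PH31 w3T0 w3PH31_efree w3T0_efree (w3PH31_deg.trans w3T0_deg.symm)
  have e3PH32 := Tz_eq_of_A1 D h1 w3PH32 w3T0 w3PH32_efree w3T0_efree (w3PH32_deg.trans w3T0_deg.symm)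
  have e3T1 := Tz_eq_of_A1 D h1 w3T1 w3T0 w3T1_efree w3T0_efree (w3T1_deg.trans w3T0_deg.symm)
  have e3T2 := Tz_eq_of_A1 D h1 w3T2 w3T0 w3T2_efree w3T0_efree (w3T2_deg.trans w3T0_deg.symm)
  have e3T3 := Tz_eq_of_A1 D h1 w3T3 w3T0 w3T3_efree w3T0_efree (w3T3_deg.trans w3T0_deg.symm)
  unfold Design.Tz at *
  rw [linZ_F24, linZ_F24, linZ_S1, linZ_S1, linZ_S2, linZ_S2, linZ_S3, linZ_S3, linZ_S4, linZ_S4]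
  linarith

/-- **RING 3 IS EMPTY** (kernel): `RingsEmpty 14 B rmin 3` for every budget `B` and rank floor `rmin`. -/
theorem ringsEmpty_colevel_three (B : ℕ) (rmin : ℤ) : RingsEmpty 14 B rmin 3 := by
  intro D hA h1 h4 hμ _ _ hc
  -- (1) P-letters are P-type
  have hP : ∀ x ∈ D.suppP, ∀ f : Fin 4, PType (x f) := by
    intro x hx f
    obtain ⟨y, hy, hlive⟩ := h4.1 x hx
    have hxA : (x f).OnAlphabet 14 := hA x (List.mem_append.mpr (Or.inr hx)) f
    have hyA : (y f).OnAlphabet 14 := hA y (List.mem_append.mpr (Or.inl hy)) f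
    have hnotaxis : ¬ (x f).isAxis := fun hax =>
      no_ample_cover_of_axis (x f) (y f) (hxA.1.trans hyA.1.symm) hax (hlive f)
    unfold Letter.isAxis at hnotaxis
    have hxx : (x f).x ≠ 0 := fun h0 => hnotaxis (by rw [h0]; ring)
    have hxy : (x f).y ≠ 0 := fun h0 => hnotaxis (by rw [h0]; ring)
    exact pType_of hxA (hc x (List.mem_append.mpr (Or.inr hx)) f) hxx hxy
  -- (2) N-letters are N-type (co-level drops by ≥ 2 under the covering P-letter of co-level ≤ 3)
  have hN : ∀ y ∈ D.suppN, ∀ f : Fin 4, NType (y f) := by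
    intro y hy f
    obtain ⟨x, hx, hlive⟩ := h4.2 y hy
    have hxA : (x f).OnAlphabet 14 := hA x (List.mem_append.mpr (Or.inr hx)) f
    have hyA : (y f).OnAlphabet 14 := hA y (List.mem_append.mpr (Or.inl hy)) f
    have hdrop := colevel_drop_two (x f) (y f) (hxA.1.trans hyA.1.symm) (hlive f)
    have hcx := hc x (List.mem_append.mpr (Or.inr hx)) f
    exact nType_of hyA (by linarith)
  -- (3) signs of the functional on the two sides
  have hNnonneg : 0 ≤ linZ D.N F24 := by
    refine linZ_nonneg D.N F24 fun cm hcm hpos => ?_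
    have hmem : cm.1 ∈ D.suppN := (mem_suppN_iff D cm.1).mpr ⟨cm.2, by simpa using hcm, hpos⟩
    exact F24_N_nonneg cm.1 (hN cm.1 hmem)
  have hPle : linZ D.P F24 ≤ (-24) * ((D.P.map Prod.snd).sum : ℕ) := by
    refine linZ_le_mul_sum D.P F24 (-24) fun cm hcm hpos => ?_
    have hmem : cm.1 ∈ D.suppP := (mem_suppP_iff D cm.1).mpr ⟨cm.2, by simpa using hcm, hpos⟩
    exact F24_P_le cm.1 (hP cm.1 hmem)
  -- (4) the (A1) rows kill the functional, so Σ_P m = 0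
  have hvan := functional_vanishes D h1
  have hsum0 : ((D.P.map Prod.snd).sum : ℤ) ≤ 0 := by
    have hnn : (0 : ℤ) ≤ ((D.P.map Prod.snd).sum : ℕ) := by exact_mod_cast Nat.zero_le _
    linarith
  have hsumP : (D.P.map Prod.snd).sum = 0 := by
    have : ((D.P.map Prod.snd).sum : ℤ) = 0 := le_antisymm hsum0 (by exact_mod_cast Nat.zero_le _)
    exact_mod_cast this
  -- (5) supports empty, μ = 0
  have hPzero : ∀ cm ∈ D.P, cm.2 = 0 := by
    intro cm hcm
    have : cm.2 ∈ D.P.map Prod.snd := List.mem_map.mpr ⟨cm, hcm, rfl⟩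
    exact (List.sum_eq_zero_iff_forall_eq_nat.mp hsumP) _ this
  have hsuppP : D.suppP = [] := by
    apply List.eq_nil_iff_forall_not_mem.mpr
    intro c hc'
    obtain ⟨m, hm, hpos⟩ := (mem_suppP_iff D c).mp hc'
    have := hPzero (c, m) hm
    simp at this; omega
  have hNzero : ∀ cm ∈ D.N, cm.2 = 0 := by
    intro cm hcm
    by_contra hne
    have hpos : 0 < cm.2 := Nat.pos_of_ne_zero hne
    have hmem : cm.1 ∈ D.suppN := (mem_suppN_iff D cm.1).mpr ⟨cm.2, by simpa using hcm, hpos⟩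
    obtain ⟨x, hx, _⟩ := h4.2 cm.1 hmem
    rw [hsuppP] at hx
    simp at hx
  apply hμ
  have hN0 : (D.N.map fun cm => (cm.2 : GaussianInt) * cellCoef cm.1 Word.eeee).sum = 0 :=
    wsum_eq_zero_of_mults_zero D.N (fun c => cellCoef c Word.eeee) hNzero
  have hP0 : (D.P.map fun cm => (cm.2 : GaussianInt) * cellCoef cm.1 Word.eeee).sum = 0 :=
    wsum_eq_zero_of_mults_zero D.P (fun c => cellCoef c Word.eeee) hPzero
  unfold Design.mu Design.T
  rw [hN0, hP0]
  simp

/-- Leg A assembled at `c₀ = 3` (director R19.377 (1)): the conjecture of record ALONE now closes the (A4) road — ring 3 is a theorem. -/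
theorem a4_closed_of_depthBound_three (hd : DepthBound 14 199 8 3) :
    ∀ D : Design, D.OnAlphabet 14 → D.A1 → D.A4 → D.mu ≠ 0 → D.copies ≤ 199 → 8 ≤ D.rank → False :=
  a4_closed_of_depthBound_and_rings 14 199 8 3 hd (ringsEmpty_colevel_three 199 8)

end ring3

/-! ## ONE-ORBIT — the (BGT) step of DB-SYM in the kernel (strengthen g6; colour-1 l.8512 «S₀-invariance + (BGT) ⇒ exactly one P orbit,
64 ≤ Σm_P ≤ 95 < 128»).  `S₀` acts freely on cells whose letters are off-axis (a quarter turn fixes no `(x, y) ≠ 0`), so the `S₀`-orbit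
of a supported P-cell is the injective image of `(Fin 4)³` (64 cells), all supported with the same multiplicity (invariance); the
budget `M ≤ 199` with rank `≥ 8` gives `Σ_P m ≤ 95`, so there is room for exactly one orbit and its multiplicity is `1`.
Sorry-free SUPPORT for the registered stub `stub_DBSym`; hypotheses ⊂ those of `DBSym` (no (A1), no `μ`). -/

section oneorbit

theorem rotPow_zero (ℓ : Letter) : ℓ.rotPow 0 = ℓ := rfl
theorem rotPow_succ (k : ℕ) (ℓ : Letter) : ℓ.rotPow (k + 1) = (ℓ.rotI).rotPow k := rfl
theorem rotPow_one (ℓ : Letter) : ℓ.rotPow 1 = ⟨ℓ.a, -ℓ.y, ℓ.x⟩ := rfl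
theorem rotPow_two (ℓ : Letter) : ℓ.rotPow 2 = ⟨ℓ.a, -ℓ.x, -ℓ.y⟩ := by
  rw [rotPow_succ, rotPow_one]; cases ℓ; simp [Letter.rotI]
theorem rotPow_three (ℓ : Letter) : ℓ.rotPow 3 = ⟨ℓ.a, ℓ.y, -ℓ.x⟩ := by
  rw [rotPow_succ, rotPow_two]; cases ℓ; simp [Letter.rotI]
theorem rotPow_four (ℓ : Letter) : ℓ.rotPow 4 = ℓ := by
  rw [rotPow_succ, rotPow_three]; cases ℓ; simp [Letter.rotI]

theorem rotPow_add (i j : ℕ) (ℓ : Letter) : (ℓ.rotPow i).rotPow j = ℓ.rotPow (j + i) := by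
  unfold Letter.rotPow; rw [Function.iterate_add_apply]

theorem rotPow_four_mul (q : ℕ) (ℓ : Letter) : ℓ.rotPow (4 * q) = ℓ := by
  unfold Letter.rotPow
  rw [Function.iterate_mul]
  exact Function.iterate_fixed (rotPow_four ℓ) q

theorem rotPow_mod4 (n : ℕ) (ℓ : Letter) : ℓ.rotPow n = ℓ.rotPow (n % 4) := by
  conv_lhs => rw [← Nat.mod_add_div n 4]
  rw [← rotPow_add, rotPow_four_mul]

/-- FREE ACTION: a letter with `x ≠ 0` (e.g. any off-axis letter) is fixed by no non-trivial quarter turn. -/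
theorem rotPow_inj (ℓ : Letter) (hx : ℓ.x ≠ 0) (i j : Fin 4) (h : ℓ.rotPow i.val = ℓ.rotPow j.val) : i = j := by
  obtain ⟨a, x, y⟩ := ℓ
  simp only at hx
  fin_cases i <;> fin_cases j <;>
    simp only [Fin.zero_eta, Fin.mk_one, Fin.isValue, Fin.reduceFinMk,
      rotPow_zero, rotPow_one, rotPow_two, rotPow_three, Letter.mk.injEq] at h ⊢ <;> omega

/-- TRANSPORT (no freeness needed): two `S₀`-translates that meet give an `S₀`-element between the base cells. -/
theorem orbit_transport (k k' : Fin 4 → Fin 4) (hk : InS0 k) (hk' : InS0 k') (x x' : Cell)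
    (h : rotCell k x = rotCell k' x') : ∃ k'' : Fin 4 → Fin 4, InS0 k'' ∧ x' = rotCell k'' x := by
  -- `k'' = k − k'`, written as `k + 3k'` to stay subtraction-free
  refine ⟨fun f => ⟨(3 * (k' f).val + (k f).val) % 4, Nat.mod_lt _ (Nat.succ_pos 3)⟩, ?_, ?_⟩
  · unfold InS0 at hk hk' ⊢
    simp only [Fin.sum_univ_four] at hk hk' ⊢
    clear h
    omega
  · funext f
    have hf := congrFun h f
    simp only [rotCell] at hf ⊢
    have step : x' f = ((x' f).rotPow (k' f).val).rotPow (3 * (k' f).val) := by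
      rw [rotPow_add, show 3 * (k' f).val + (k' f).val = 4 * (k' f).val by ring, rotPow_four_mul]
    rw [step, ← hf, rotPow_add, rotPow_mod4]

/-- `S₀ ≅ (ℤ∕4)³`: the element with prescribed first three coordinates. -/
def s0of (t : Fin 4 × Fin 4 × Fin 4) : Fin 4 → Fin 4 :=
  ![t.1, t.2.1, t.2.2, ⟨(12 - (t.1.val + t.2.1.val + t.2.2.val)) % 4, Nat.mod_lt _ (Nat.succ_pos 3)⟩]

theorem s0of_mem (t : Fin 4 × Fin 4 × Fin 4) : InS0 (s0of t) := by
  obtain ⟨t1, t2, t3⟩ := t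
  unfold InS0 s0of
  simp only [Fin.sum_univ_four, Matrix.cons_val_zero, Matrix.cons_val_one, Matrix.head_cons, Matrix.cons_val_two,
    Matrix.tail_cons, Matrix.cons_val_three]
  have h1 := t1.isLt; have h2 := t2.isLt; have h3 := t3.isLt
  omega

theorem rotCell_s0of_injective (x : Cell) (hx : ∀ f, (x f).x ≠ 0) :
    Function.Injective (fun t : Fin 4 × Fin 4 × Fin 4 => rotCell (s0of t) x) := by
  intro t t' h
  have hf : ∀ f, s0of t f = s0of t' f := fun f =>
    rotPow_inj (x f) (hx f) _ _ (congrFun h f)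
  obtain ⟨t1, t2, t3⟩ := t
  obtain ⟨u1, u2, u3⟩ := t'
  have e0 := hf 0; have e1 := hf 1; have e2 := hf 2
  simp only [s0of, Matrix.cons_val_zero, Matrix.cons_val_one, Matrix.head_cons, Matrix.cons_val_two, Matrix.tail_cons] at e0 e1 e2
  simp [e0, e1, e2]

/-- The `S₀`-orbit of a cell, as a finset (image of `(Fin 4)³`). -/
def orbitP (x : Cell) : Finset Cell := (Finset.univ : Finset (Fin 4 × Fin 4 × Fin 4)).image (fun t => rotCell (s0of t) x)

theorem card_orbitP (x : Cell) (hx : ∀ f, (x f).x ≠ 0) : (orbitP x).card = 64 := by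
  unfold orbitP
  rw [Finset.card_image_of_injective _ (rotCell_s0of_injective x hx), Finset.card_univ]
  simp [Fintype.card_prod, Fintype.card_fin]

theorem mem_orbitP (x c : Cell) : c ∈ orbitP x ↔ ∃ t : Fin 4 × Fin 4 × Fin 4, rotCell (s0of t) x = c := by
  unfold orbitP; simp [Finset.mem_image]

/-! ### Multiplicity bookkeeping -/

/-- cell-summed multiplicity of a list of entries (`Design.mP D = mPL D.P`). -/
def mPL (L : List (Cell × ℕ)) (c : Cell) : ℕ := ((L.filter fun cm => cm.1 = c).map Prod.snd).sum

theorem mP_eq_mPL (D : Design) (c : Cell) : D.mP c = mPL D.P c := rfl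

theorem mPL_cons (a : Cell × ℕ) (t : List (Cell × ℕ)) (c : Cell) :
    mPL (a :: t) c = (if a.1 = c then a.2 else 0) + mPL t c := by
  unfold mPL
  by_cases h : a.1 = c <;> simp [h]

/-- regrouping inequality: the multiplicities of any set of distinct cells add up to at most the copy count of the side. -/
theorem sum_mPL_le (L : List (Cell × ℕ)) (S : Finset Cell) : ∑ c ∈ S, mPL L c ≤ (L.map Prod.snd).sum := by
  induction L with
  | nil => simp [mPL]
  | cons a t ih =>
    simp only [mPL_cons, Finset.sum_add_distrib, List.map_cons, List.sum_cons]
    have h1 : (∑ c ∈ S, if a.1 = c then a.2 else 0) ≤ a.2 := by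
      rw [Finset.sum_ite_eq]; split <;> omega
    omega

theorem mem_suppP_iff_mP_pos (D : Design) (c : Cell) : c ∈ D.suppP ↔ 0 < D.mP c := by
  rw [mem_suppP_iff]
  constructor
  · rintro ⟨m, hm, hpos⟩
    have hmem : m ∈ (D.P.filter fun cm => cm.1 = c).map Prod.snd :=
      List.mem_map.mpr ⟨(c, m), List.mem_filter.mpr ⟨hm, by simp⟩, rfl⟩
    exact lt_of_lt_of_le hpos (List.le_sum_of_mem hmem)
  · intro hpos
    by_contra hno
    have h0 : ((D.P.filter fun cm => cm.1 = c).map Prod.snd).sum = 0 := by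
      apply List.sum_eq_zero
      intro m hm
      obtain ⟨cm, hcm, rfl⟩ := List.mem_map.mp hm
      obtain ⟨hP, hc⟩ := List.mem_filter.mp hcm
      have hc' : cm.1 = c := by simpa using hc
      by_contra hmne
      exact hno ⟨cm.2, by rw [← hc']; exact hP, Nat.pos_of_ne_zero hmne⟩
    unfold Design.mP at hpos
    omega

/-- (BGT) with (RK): `Σ_P m ≤ 95`. -/
theorem sumP_le_of_budget (D : Design) (hB : D.copies ≤ 199) (hr : 8 ≤ D.rank) : (D.P.map Prod.snd).sum ≤ 95 := by
  unfold Design.copies at hB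
  unfold Design.rank at hr
  omega

/-! ### Design-level consequences -/

/-- every letter of a supported P-cell is off the `x = 0` axis (indeed off both axes), by (CONN) + (A4♯) + CLAIM 1. -/
theorem suppP_x_ne_zero (D : Design) (hA : D.OnAlphabet 14) (h4 : D.A4sharp) (hC : D.CONN) :
    ∀ x ∈ D.suppP, ∀ f : Fin 4, (x f).x ≠ 0 := by
  intro x hx f h0
  obtain ⟨y, hy, hweak⟩ := hC.1 x hx
  have hlive : Live x y := h4 x hx y hy hweak
  have hxA : (x f).OnAlphabet 14 := hA x (List.mem_append.mpr (Or.inr hx)) f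
  have hyA : (y f).OnAlphabet 14 := hA y (List.mem_append.mpr (Or.inl hy)) f
  exact no_ample_cover_of_axis (x f) (y f) (hxA.1.trans hyA.1.symm) (by unfold Letter.isAxis; rw [h0]; ring) (hlive f)

theorem mP_rotCell (D : Design) (hS : D.S0Invariant) (k : Fin 4 → Fin 4) (hk : InS0 k) (x : Cell) :
    D.mP (rotCell k x) = D.mP x := (hS k hk x).2

theorem sum_orbitP (D : Design) (hS : D.S0Invariant) (x : Cell) (hx : ∀ f, (x f).x ≠ 0) :
    ∑ c ∈ orbitP x, D.mP c = 64 * D.mP x := by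
  rw [Finset.sum_congr rfl (fun c hc => ?_ : ∀ c ∈ orbitP x, D.mP c = D.mP x), Finset.sum_const, card_orbitP x hx,
    smul_eq_mul]
  obtain ⟨t, rfl⟩ := (mem_orbitP x c).mp hc
  exact mP_rotCell D hS (s0of t) (s0of_mem t) x

/-- **ONE-ORBIT**: under the DB-SYM hypotheses (minus (A1), `μ`), the P-support lies in a single `S₀`-orbit. -/
theorem one_orbit (D : Design) (hS : D.S0Invariant) (hA : D.OnAlphabet 14) (h4 : D.A4sharp) (hC : D.CONN)
    (hB : D.copies ≤ 199) (hr : 8 ≤ D.rank) :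
    ∀ x ∈ D.suppP, ∀ x' ∈ D.suppP, ∃ k : Fin 4 → Fin 4, InS0 k ∧ x' = rotCell k x := by
  intro x hx x' hx'
  by_contra hne
  have hxf := suppP_x_ne_zero D hA h4 hC x hx
  have hxf' := suppP_x_ne_zero D hA h4 hC x' hx'
  have hdisj : Disjoint (orbitP x) (orbitP x') := by
    rw [Finset.disjoint_left]
    intro c hc hc'
    obtain ⟨t, rfl⟩ := (mem_orbitP x c).mp hc
    obtain ⟨t', ht'⟩ := (mem_orbitP x' _).mp hc'
    obtain ⟨k'', hk'', hx''⟩ := orbit_transport (s0of t) (s0of t') (s0of_mem t) (s0of_mem t') x x' ht'.symm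
    exact hne ⟨k'', hk'', hx''⟩
  have hsum := sum_mPL_le D.P (orbitP x ∪ orbitP x')
  rw [Finset.sum_union hdisj] at hsum
  simp only [← mP_eq_mPL] at hsum
  rw [sum_orbitP D hS x hxf, sum_orbitP D hS x' hxf'] at hsum
  have h1 : 0 < D.mP x := (mem_suppP_iff_mP_pos D x).mp hx
  have h2 : 0 < D.mP x' := (mem_suppP_iff_mP_pos D x').mp hx'
  have h95 := sumP_le_of_budget D hB hr
  omega

/-- … and every supported P-cell has multiplicity exactly `1` (`64·m ≤ 95`). -/
theorem mP_eq_one (D : Design) (hS : D.S0Invariant) (hA : D.OnAlphabet 14) (h4 : D.A4sharp) (hC : D.CONN)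
    (hB : D.copies ≤ 199) (hr : 8 ≤ D.rank) : ∀ x ∈ D.suppP, D.mP x = 1 := by
  intro x hx
  have hxf := suppP_x_ne_zero D hA h4 hC x hx
  have hsum := sum_mPL_le D.P (orbitP x)
  simp only [← mP_eq_mPL] at hsum
  rw [sum_orbitP D hS x hxf] at hsum
  have h1 : 0 < D.mP x := (mem_suppP_iff_mP_pos D x).mp hx
  have h95 := sumP_le_of_budget D hB hr
  omega

/-- … so `64 ≤ Σ_P m ≤ 95` whenever the P-support is non-empty. -/
theorem sumP_ge_64 (D : Design) (hS : D.S0Invariant) (hA : D.OnAlphabet 14) (h4 : D.A4sharp) (hC : D.CONN)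
    (x : Cell) (hx : x ∈ D.suppP) : 64 ≤ (D.P.map Prod.snd).sum := by
  have hxf := suppP_x_ne_zero D hA h4 hC x hx
  have hsum := sum_mPL_le D.P (orbitP x)
  simp only [← mP_eq_mPL] at hsum
  rw [sum_orbitP D hS x hxf] at hsum
  have h1 : 0 < D.mP x := (mem_suppP_iff_mP_pos D x).mp hx
  omega

end oneorbit

/-! ## PROFILE NORMAL FORM (strengthen g6): what the (A1) e-free rows look like once ONE-ORBIT has fixed the P side.
Under the DB-SYM hypotheses the P side is one free `S₀`-orbit of some `x₀` at multiplicity `1`; e-free coefficients (`h ↦ a`,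
`pt ↦ a² − b`) are rotation-invariant, so for every e-free word `w`: `Tz w = Σ_N m·icellCoef(·, w) − 64 · icellCoef(x₀, w)`, and the
(A1) equal-degree rows become `Σ_N m·(icellCoef(·,w) − icellCoef(·,w')) = 64 · (icellCoef(x₀,w) − icellCoef(x₀,w'))` — the linear
system colour-1's per-profile LP certificates (l.8512) refute profile by profile.  This is the prover's starting line for the PROFILE step. -/

section profile

/-- regrouping EQUALITY: a weighted list sum is the finset sum of cell-multiplicities, over any finset containing the positive entries. -/
theorem linZ_eq_sum (L : List (Cell × ℕ)) (φ : Cell → ℤ) (S : Finset Cell) (hS : ∀ cm ∈ L, 0 < cm.2 → cm.1 ∈ S) :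
    linZ L φ = ∑ c ∈ S, (mPL L c : ℤ) * φ c := by
  induction L with
  | nil => simp [linZ, mPL]
  | cons a t ih =>
    have ht : ∀ cm ∈ t, 0 < cm.2 → cm.1 ∈ S := fun cm hcm => hS cm (List.mem_cons_of_mem _ hcm)
    rw [linZ_cons, ih ht]
    simp only [mPL_cons, Nat.cast_add, Nat.cast_ite, Nat.cast_zero, add_mul, Finset.sum_add_distrib]
    have key : ∑ c ∈ S, (if a.1 = c then (a.2 : ℤ) else 0) * φ c = (a.2 : ℤ) * φ a.1 := by
      simp only [ite_mul, zero_mul, Finset.sum_ite_eq]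
      split_ifs with hmem
      · rfl
      · rcases Nat.eq_zero_or_pos a.2 with h0 | hpos
        · rw [h0]; simp
        · exact absurd (hS a List.mem_cons_self hpos) hmem
    rw [key]

theorem rotI_a (ℓ : Letter) : ℓ.rotI.a = ℓ.a := rfl

theorem rotI_selfInt (ℓ : Letter) : ℓ.rotI.selfInt = ℓ.selfInt := by
  cases ℓ; simp [Letter.rotI, Letter.selfInt, Letter.bnorm]; ring

theorem rotPow_a (j : ℕ) (ℓ : Letter) : (ℓ.rotPow j).a = ℓ.a := by
  induction j generalizing ℓ with
  | zero => rfl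
  | succ j ih => rw [rotPow_succ, ih, rotI_a]

theorem rotPow_selfInt (j : ℕ) (ℓ : Letter) : (ℓ.rotPow j).selfInt = ℓ.selfInt := by
  induction j generalizing ℓ with
  | zero => rfl
  | succ j ih => rw [rotPow_succ, ih, rotI_selfInt]

/-- e-free coefficients are rotation-invariant. -/
theorem icoef_rotPow (s : Sym) (hs : s.efree = true) (j : ℕ) (ℓ : Letter) : s.icoef (ℓ.rotPow j) = s.icoef ℓ := by
  cases s <;> simp [Sym.efree] at hs <;> simp [Sym.icoef, rotPow_a, rotPow_selfInt]

theorem icellCoef_rotCell (k : Fin 4 → Fin 4) (c : Cell) (w : Word) (hw : w.efree) :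
    icellCoef (rotCell k c) w = icellCoef c w := by
  unfold icellCoef rotCell
  exact Finset.prod_congr rfl fun f _ => icoef_rotPow (w f) (hw f) _ _

theorem sum_orbitP_icellCoef (x₀ : Cell) (hx : ∀ f, (x₀ f).x ≠ 0) (w : Word) (hw : w.efree) :
    ∑ c ∈ orbitP x₀, icellCoef c w = 64 * icellCoef x₀ w := by
  rw [Finset.sum_congr rfl (fun c hc => ?_ : ∀ c ∈ orbitP x₀, icellCoef c w = icellCoef x₀ w), Finset.sum_const,
    card_orbitP x₀ hx, nsmul_eq_mul]
  · norm_num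
  · obtain ⟨t, rfl⟩ := (mem_orbitP x₀ c).mp hc
    exact icellCoef_rotCell (s0of t) x₀ w hw

/-- every `k ∈ S₀` is an `s0of`. -/
theorem s0of_of_mem (k : Fin 4 → Fin 4) (hk : InS0 k) : s0of (k 0, k 1, k 2) = k := by
  unfold InS0 at hk
  simp only [Fin.sum_univ_four] at hk
  have h0 := (k 0).isLt; have h1 := (k 1).isLt; have h2 := (k 2).isLt; have h3 := (k 3).isLt
  have e3 : (12 - ((k 0).val + (k 1).val + (k 2).val)) % 4 = (k 3).val := by omega
  funext f
  fin_cases f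
  · simp [s0of]
  · simp [s0of]
  · simp [s0of]
  · simp only [s0of, Fin.reduceFinMk, Matrix.cons_val]
    exact Fin.ext e3

theorem rotCell_mem_orbitP (k : Fin 4 → Fin 4) (hk : InS0 k) (x : Cell) : rotCell k x ∈ orbitP x :=
  (mem_orbitP x _).mpr ⟨(k 0, k 1, k 2), by rw [s0of_of_mem k hk]⟩

theorem linZ_const_one (L : List (Cell × ℕ)) : linZ L (fun _ => (1 : ℤ)) = ((L.map Prod.snd).sum : ℕ) := by
  induction L with
  | nil => simp [linZ]
  | cons a t ih => rw [linZ_cons, ih, List.map_cons, List.sum_cons, Nat.cast_add]; simp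

/-- **PROFILE NORMAL FORM** of the integer tensor on e-free words, under the DB-SYM hypotheses. -/
theorem profile_normal_form (D : Design) (hS : D.S0Invariant) (hA : D.OnAlphabet 14) (h4 : D.A4sharp) (hC : D.CONN)
    (hB : D.copies ≤ 199) (hr : 8 ≤ D.rank) (x₀ : Cell) (hx₀ : x₀ ∈ D.suppP) (w : Word) (hw : w.efree) :
    D.Tz w = linZ D.N (fun c => icellCoef c w) - 64 * icellCoef x₀ w := by
  have hxf := suppP_x_ne_zero D hA h4 hC x₀ hx₀
  have h1 : D.mP x₀ = 1 := mP_eq_one D hS hA h4 hC hB hr x₀ hx₀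
  -- every positive P entry lies in the orbit of x₀
  have hS' : ∀ cm ∈ D.P, 0 < cm.2 → cm.1 ∈ orbitP x₀ := by
    intro cm hcm hpos
    have hmem : cm.1 ∈ D.suppP := (mem_suppP_iff D cm.1).mpr ⟨cm.2, by simpa using hcm, hpos⟩
    obtain ⟨k, hk, hk'⟩ := one_orbit D hS hA h4 hC hB hr x₀ hx₀ cm.1 hmem
    rw [hk']
    exact rotCell_mem_orbitP k hk x₀
  have hP : linZ D.P (fun c => icellCoef c w) = 64 * icellCoef x₀ w := by
    rw [linZ_eq_sum D.P _ (orbitP x₀) hS', ← sum_orbitP_icellCoef x₀ hxf w hw]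
    refine Finset.sum_congr rfl fun c hc => ?_
    obtain ⟨t, rfl⟩ := (mem_orbitP x₀ c).mp hc
    rw [← mP_eq_mPL, mP_rotCell D hS (s0of t) (s0of_mem t) x₀, h1]
    simp
  unfold Design.Tz
  rw [hP]

/-- The (A1) equal-degree rows in PROFILE form. -/
theorem A1_rows_profile (D : Design) (hS : D.S0Invariant) (hA : D.OnAlphabet 14) (hA1 : D.A1) (h4 : D.A4sharp)
    (hC : D.CONN) (hB : D.copies ≤ 199) (hr : 8 ≤ D.rank) (x₀ : Cell) (hx₀ : x₀ ∈ D.suppP)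
    (w w' : Word) (hw : w.efree) (hw' : w'.efree) (hd : w.deg = w'.deg) :
    linZ D.N (fun c => icellCoef c w) - linZ D.N (fun c => icellCoef c w') = 64 * (icellCoef x₀ w - icellCoef x₀ w') := by
  have e := Tz_eq_of_A1 D hA1 w w' hw hw' hd
  rw [profile_normal_form D hS hA h4 hC hB hr x₀ hx₀ w hw, profile_normal_form D hS hA h4 hC hB hr x₀ hx₀ w' hw'] at e
  linarith

/-- … and the rank ∕ budget window of the N side: `72 ≤ Σ_N m ≤ 135` (since `Σ_P m = 64`). -/
theorem sumN_window (D : Design) (hS : D.S0Invariant) (hA : D.OnAlphabet 14) (h4 : D.A4sharp) (hC : D.CONN)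
    (hB : D.copies ≤ 199) (hr : 8 ≤ D.rank) (x₀ : Cell) (hx₀ : x₀ ∈ D.suppP) :
    (D.P.map Prod.snd).sum = 64 ∧ 72 ≤ (D.N.map Prod.snd).sum ∧ (D.N.map Prod.snd).sum ≤ 135 := by
  have hxf := suppP_x_ne_zero D hA h4 hC x₀ hx₀
  have h1 : D.mP x₀ = 1 := mP_eq_one D hS hA h4 hC hB hr x₀ hx₀
  have hS' : ∀ cm ∈ D.P, 0 < cm.2 → cm.1 ∈ orbitP x₀ := by
    intro cm hcm hpos
    have hmem : cm.1 ∈ D.suppP := (mem_suppP_iff D cm.1).mpr ⟨cm.2, by simpa using hcm, hpos⟩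
    obtain ⟨k, hk, hk'⟩ := one_orbit D hS hA h4 hC hB hr x₀ hx₀ cm.1 hmem
    rw [hk']
    exact rotCell_mem_orbitP k hk x₀
  have hP64 : ((D.P.map Prod.snd).sum : ℤ) = 64 := by
    have e := linZ_eq_sum D.P (fun _ => (1 : ℤ)) (orbitP x₀) hS'
    have r1 : ∑ c ∈ orbitP x₀, (mPL D.P c : ℤ) * 1 = 64 := by
      rw [Finset.sum_congr rfl (fun c hc => ?_ : ∀ c ∈ orbitP x₀, (mPL D.P c : ℤ) * 1 = 1), Finset.sum_const,
        card_orbitP x₀ hxf]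
      · simp
      · obtain ⟨t, rfl⟩ := (mem_orbitP x₀ c).mp hc
        rw [← mP_eq_mPL, mP_rotCell D hS (s0of t) (s0of_mem t) x₀, h1]; simp
    rw [← linZ_const_one, e, r1]
  have hP64' : (D.P.map Prod.snd).sum = 64 := by exact_mod_cast hP64
  unfold Design.copies at hB
  unfold Design.rank at hr
  refine ⟨hP64', ?_, ?_⟩ <;> omega

/-- The admissibility side of the profile LP: every supported N-cell is FOUR-AMPLE above some `S₀`-rotation of `x₀`
(CONN.2 + (A4♯) + ONE-ORBIT). -/
theorem N_above_orbit (D : Design) (hS : D.S0Invariant) (hA : D.OnAlphabet 14) (h4 : D.A4sharp) (hC : D.CONN)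
    (hB : D.copies ≤ 199) (hr : 8 ≤ D.rank) (x₀ : Cell) (hx₀ : x₀ ∈ D.suppP) :
    ∀ y ∈ D.suppN, ∃ k : Fin 4 → Fin 4, InS0 k ∧ Live (rotCell k x₀) y := by
  intro y hy
  obtain ⟨x, hx, hweak⟩ := hC.2 y hy
  have hlive : Live x y := h4 x hx y hy hweak
  obtain ⟨k, hk, rfl⟩ := one_orbit D hS hA h4 hC hB hr x₀ hx₀ x hx
  exact ⟨k, hk, hlive⟩

theorem rotI_colevel (ℓ : Letter) : ℓ.rotI.colevel = ℓ.colevel := by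
  cases ℓ; simp only [Letter.rotI, Letter.colevel, abs_neg]; ring

theorem rotPow_colevel (j : ℕ) (ℓ : Letter) : (ℓ.rotPow j).colevel = ℓ.colevel := by
  induction j generalizing ℓ with
  | zero => rfl
  | succ j ih => rw [rotPow_succ, ih, rotI_colevel]

/-- … and, letter by letter, STRICT-SHRINK places every N-letter strictly inside the box of a rotation of the corresponding
`x₀`-letter: `|y_f.x| + 1 ≤ |x₀_f.x|′` and `|y_f.y| + 1 ≤ |x₀_f.y|′` where ′ = after `k_f` quarter turns (so co-level(y_f) ≤ co-level(x₀_f) − 2). -/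
theorem N_colevel_le (D : Design) (hS : D.S0Invariant) (hA : D.OnAlphabet 14) (h4 : D.A4sharp) (hC : D.CONN)
    (hB : D.copies ≤ 199) (hr : 8 ≤ D.rank) (x₀ : Cell) (hx₀ : x₀ ∈ D.suppP) :
    ∀ y ∈ D.suppN, ∀ f : Fin 4, (y f).colevel + 2 ≤ (x₀ f).colevel := by
  intro y hy f
  obtain ⟨k, hk, hlive⟩ := N_above_orbit D hS hA h4 hC hB hr x₀ hx₀ y hy
  have hxs : rotCell k x₀ ∈ D.suppP := by
    rw [mem_suppP_iff_mP_pos, mP_rotCell D hS k hk x₀]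
    exact (mem_suppP_iff_mP_pos D x₀).mp hx₀
  have hxA : (rotCell k x₀ f).OnAlphabet 14 := hA _ (List.mem_append.mpr (Or.inr hxs)) f
  have hyA : (y f).OnAlphabet 14 := hA y (List.mem_append.mpr (Or.inl hy)) f
  have hdrop := colevel_drop_two (rotCell k x₀ f) (y f) (hxA.1.trans hyA.1.symm) (hlive f)
  have hrot : (rotCell k x₀ f).colevel = (x₀ f).colevel := rotPow_colevel _ _
  omega

end profile

/-! ## S₀ KILLS MIXED WORDS (strengthen g6): the (A1).1 half is AUTOMATIC for `S₀`-invariant designs.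
A quarter turn multiplies the `e`-coefficient by `−i`, the `ē`-coefficient by `i` and fixes the e-free ones; hence
`cellCoef (rotCell k c) w = ρ(w,k) · cellCoef c w` with `ρ(w,k) = ∏_f phase(w_f)^{k_f}`, and re-indexing the (finite) support sum of an
`S₀`-invariant side by `rotCell k` gives `Σ = ρ · Σ`.  A word whose four phases are not all equal admits `k ∈ S₀` with `ρ ≠ 1`, so its
tensor coefficient vanishes on BOTH sides separately.  Consequently an `S₀`-invariant design satisfies (A1).1 for free, and (A1) reduces to the
e-free equal-degree rows (A1).2 — the claim behind colour-1's DB-SYM model («S₀ = the rotation subgroup whose orbit sums kill every e-mixed word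
and keep μ», crit-hsem-2 ∕ colour-1) is now a kernel theorem for list-presented integer designs. -/

section s0kills

/-- Quarter-turn phase of a symbol: `e ↦ −i`, `ē ↦ i`, e-free symbols `↦ 1`. -/
def Sym.phase : Sym → GaussianInt
  | Sym.e => ⟨0, -1⟩
  | Sym.ebar => ⟨0, 1⟩
  | Sym.one => 1
  | Sym.h => 1
  | Sym.pt => 1

theorem beta_rotI (ℓ : Letter) : ℓ.rotI.beta = ⟨0, 1⟩ * ℓ.beta := by
  cases ℓ; ext <;> simp [Letter.rotI, Letter.beta]

theorem coef_rotI (s : Sym) (ℓ : Letter) : s.coef ℓ.rotI = s.phase * s.coef ℓ := by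
  cases s with
  | one => simp [Sym.coef, Sym.phase]
  | h => simp [Sym.coef, Sym.phase, rotI_a]
  | e =>
    simp only [Sym.coef, Sym.phase]
    cases ℓ; ext <;> simp [Letter.rotI, Letter.beta]
  | ebar => simp only [Sym.coef, Sym.phase]; exact beta_rotI ℓ
  | pt => simp [Sym.coef, Sym.phase, rotI_selfInt]

theorem coef_rotPow (s : Sym) (j : ℕ) (ℓ : Letter) : s.coef (ℓ.rotPow j) = s.phase ^ j * s.coef ℓ := by
  induction j generalizing ℓ with
  | zero => simp [rotPow_zero]
  | succ j ih => rw [rotPow_succ, ih, coef_rotI, pow_succ]; ring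

/-- The phase `ρ(w,k) = ∏_f phase(w_f)^{k_f}` picked up by the word `w` under `rotCell k`. -/
def Word.rotPhase (w : Word) (k : Fin 4 → Fin 4) : GaussianInt := ∏ f : Fin 4, (w f).phase ^ (k f).val

theorem cellCoef_rotCell_phase (k : Fin 4 → Fin 4) (c : Cell) (w : Word) :
    cellCoef (rotCell k c) w = w.rotPhase k * cellCoef c w := by
  unfold cellCoef rotCell Word.rotPhase
  rw [← Finset.prod_mul_distrib]
  exact Finset.prod_congr rfl fun f _ => coef_rotPow (w f) (k f).val (c f)

/-- `ℤ[i]`-weighted list sums and their regrouping EQUALITY (cf. `linZ_eq_sum`). -/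
def linG (L : List (Cell × ℕ)) (φ : Cell → GaussianInt) : GaussianInt := (L.map fun cm => (cm.2 : GaussianInt) * φ cm.1).sum

theorem linG_cons (a : Cell × ℕ) (t : List (Cell × ℕ)) (φ : Cell → GaussianInt) :
    linG (a :: t) φ = (a.2 : GaussianInt) * φ a.1 + linG t φ := by
  simp [linG]

theorem linG_eq_sum (L : List (Cell × ℕ)) (φ : Cell → GaussianInt) (S : Finset Cell) (hS : ∀ cm ∈ L, 0 < cm.2 → cm.1 ∈ S) :
    linG L φ = ∑ c ∈ S, (mPL L c : GaussianInt) * φ c := by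
  induction L with
  | nil => simp [linG, mPL]
  | cons a t ih =>
    have ht : ∀ cm ∈ t, 0 < cm.2 → cm.1 ∈ S := fun cm hcm => hS cm (List.mem_cons_of_mem _ hcm)
    rw [linG_cons, ih ht]
    simp only [mPL_cons, Nat.cast_add, Nat.cast_ite, Nat.cast_zero, add_mul, Finset.sum_add_distrib]
    have key : ∑ c ∈ S, (if a.1 = c then (a.2 : GaussianInt) else 0) * φ c = (a.2 : GaussianInt) * φ a.1 := by
      simp only [ite_mul, zero_mul, Finset.sum_ite_eq]
      split_ifs with hmem
      · rfl
      · rcases Nat.eq_zero_or_pos a.2 with h0 | hpos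
        · rw [h0]; simp
        · exact absurd (hS a List.mem_cons_self hpos) hmem
    rw [key]

theorem T_eq_linG (D : Design) (w : Word) :
    D.T w = linG D.N (fun c => cellCoef c w) - linG D.P (fun c => cellCoef c w) := rfl

theorem mN_eq_mPL (D : Design) (c : Cell) : D.mN c = mPL D.N c := rfl

/-- The support finset of a list side and its description by multiplicity. -/
def suppL (L : List (Cell × ℕ)) : Finset Cell := ((L.filter fun cm => 0 < cm.2).map Prod.fst).toFinset

theorem mem_suppL_iff (L : List (Cell × ℕ)) (c : Cell) : c ∈ suppL L ↔ 0 < mPL L c := by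
  unfold suppL
  rw [List.mem_toFinset]
  constructor
  · intro hc
    obtain ⟨cm, hcm, rfl⟩ := List.mem_map.mp hc
    obtain ⟨hmem, hpos⟩ := List.mem_filter.mp hcm
    have hpos' : 0 < cm.2 := by simpa using hpos
    have hm : cm.2 ∈ (L.filter fun cm' => cm'.1 = cm.1).map Prod.snd :=
      List.mem_map.mpr ⟨cm, List.mem_filter.mpr ⟨hmem, by simp⟩, rfl⟩
    exact lt_of_lt_of_le hpos' (List.le_sum_of_mem hm)
  · intro hpos
    by_contra hno
    have h0 : ((L.filter fun cm => cm.1 = c).map Prod.snd).sum = 0 := by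
      apply List.sum_eq_zero
      intro m hm
      obtain ⟨cm, hcm, rfl⟩ := List.mem_map.mp hm
      obtain ⟨hL, hc⟩ := List.mem_filter.mp hcm
      have hc' : cm.1 = c := by simpa using hc
      by_contra hmne
      exact hno (List.mem_map.mpr ⟨cm, List.mem_filter.mpr ⟨hL, by simpa using Nat.pos_of_ne_zero hmne⟩, hc'⟩)
    unfold mPL at hpos
    omega

theorem suppL_spec (L : List (Cell × ℕ)) : ∀ cm ∈ L, 0 < cm.2 → cm.1 ∈ suppL L := by
  intro cm hcm hpos
  unfold suppL
  exact List.mem_toFinset.mpr (List.mem_map.mpr ⟨cm, List.mem_filter.mpr ⟨hcm, by simpa using hpos⟩, rfl⟩)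

/-- The inverse rotation vector `3k (mod 4)`; it lies in `S₀` when `k` does. -/
def k3 (k : Fin 4 → Fin 4) : Fin 4 → Fin 4 := fun f => ⟨(3 * (k f).val) % 4, Nat.mod_lt _ (by norm_num)⟩

theorem k3_mem (k : Fin 4 → Fin 4) (hk : InS0 k) : InS0 (k3 k) := by
  unfold InS0 at *
  simp only [Fin.sum_univ_four, k3] at *
  omega

theorem rotCell_k3_left (k : Fin 4 → Fin 4) (c : Cell) : rotCell (k3 k) (rotCell k c) = c := by
  funext f
  simp only [rotCell, k3]
  rw [← rotPow_mod4, rotPow_add, show 3 * (k f).val + (k f).val = 4 * (k f).val by ring, rotPow_four_mul]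

theorem rotCell_k3_right (k : Fin 4 → Fin 4) (c : Cell) : rotCell k (rotCell (k3 k) c) = c := by
  funext f
  simp only [rotCell, k3]
  rw [rotPow_add, rotPow_mod4, show ((k f).val + 3 * (k f).val % 4) % 4 = 0 by omega, rotPow_zero]

/-- RE-INDEXING: a `rotCell k`-invariant list side picks up exactly the phase `ρ(w,k)`. -/
theorem linG_rot (L : List (Cell × ℕ)) (k : Fin 4 → Fin 4) (hinv : ∀ c, mPL L (rotCell k c) = mPL L c) (w : Word) :
    linG L (fun c => cellCoef c w) = w.rotPhase k * linG L (fun c => cellCoef c w) := by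
  rw [linG_eq_sum L _ (suppL L) (suppL_spec L), Finset.mul_sum]
  have hmemrot : ∀ c, c ∈ suppL L → rotCell k c ∈ suppL L := by
    intro c hc; rw [mem_suppL_iff] at hc ⊢; rw [hinv]; exact hc
  have hmemrot3 : ∀ c, c ∈ suppL L → rotCell (k3 k) c ∈ suppL L := by
    intro c hc; rw [mem_suppL_iff] at hc ⊢
    have e := hinv (rotCell (k3 k) c)
    rw [rotCell_k3_right] at e
    omega
  have step : ∑ c ∈ suppL L, (mPL L (rotCell k c) : GaussianInt) * cellCoef (rotCell k c) w
      = ∑ c ∈ suppL L, (mPL L c : GaussianInt) * cellCoef c w :=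
    Finset.sum_nbij' (fun c => rotCell k c) (fun c => rotCell (k3 k) c) (fun c hc => hmemrot c hc)
      (fun c hc => hmemrot3 c hc) (fun c _ => rotCell_k3_left k c) (fun c _ => rotCell_k3_right k c) (fun c _ => rfl)
  rw [← step]
  refine Finset.sum_congr rfl fun c _ => ?_
  rw [hinv c, cellCoef_rotCell_phase]
  ring

/-- If some `k ∈ S₀`… in fact any `k` leaving the side invariant … has `ρ(w,k) ≠ 1`, the side's coefficient of `w` vanishes. -/
theorem linG_eq_zero_of_phase (L : List (Cell × ℕ)) (k : Fin 4 → Fin 4) (hinv : ∀ c, mPL L (rotCell k c) = mPL L c)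
    (w : Word) (hρ : w.rotPhase k ≠ 1) : linG L (fun c => cellCoef c w) = 0 := by
  have h := linG_rot L k hinv w
  have h' : (1 - w.rotPhase k) * linG L (fun c => cellCoef c w) = 0 := by linear_combination h
  rcases mul_eq_zero.mp h' with h1 | h1
  · exact absurd (sub_eq_zero.mp h1).symm hρ
  · exact h1

/-- The three test vectors `k₀ⱼ = 3·δ₀ + δⱼ ∈ S₀`. -/
def k01 : Fin 4 → Fin 4 := ![3, 1, 0, 0]
def k02 : Fin 4 → Fin 4 := ![3, 0, 1, 0]
def k03 : Fin 4 → Fin 4 := ![3, 0, 0, 1]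

theorem k01_mem : InS0 k01 := by
  unfold InS0 k01
  simp [Fin.sum_univ_four]
theorem k02_mem : InS0 k02 := by
  unfold InS0 k02
  simp [Fin.sum_univ_four]
theorem k03_mem : InS0 k03 := by
  unfold InS0 k03
  simp [Fin.sum_univ_four]

theorem phase_pow3_mul_ne_one (s t : Sym) (h : t.phase ≠ s.phase) : s.phase ^ 3 * t.phase ≠ 1 := by
  cases s <;> cases t <;> simp [Sym.phase] at h ⊢ <;> decide

theorem rotPhase_k01 (w : Word) : w.rotPhase k01 = (w 0).phase ^ 3 * (w 1).phase := by
  simp [Word.rotPhase, Fin.prod_univ_four, k01]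
theorem rotPhase_k02 (w : Word) : w.rotPhase k02 = (w 0).phase ^ 3 * (w 2).phase := by
  simp [Word.rotPhase, Fin.prod_univ_four, k02]
theorem rotPhase_k03 (w : Word) : w.rotPhase k03 = (w 0).phase ^ 3 * (w 3).phase := by
  simp [Word.rotPhase, Fin.prod_univ_four, k03]

/-- A MIXED-PHASE word: some factor's phase differs from factor 0's. -/
def Word.mixedPhase (w : Word) : Prop := ∃ f : Fin 4, (w f).phase ≠ (w 0).phase

theorem exists_S0_phase_ne_one (w : Word) (hw : w.mixedPhase) : ∃ k : Fin 4 → Fin 4, InS0 k ∧ w.rotPhase k ≠ 1 := by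
  obtain ⟨f, hf⟩ := hw
  fin_cases f
  · exact absurd rfl hf
  · exact ⟨k01, k01_mem, by rw [rotPhase_k01]; exact phase_pow3_mul_ne_one _ _ hf⟩
  · exact ⟨k02, k02_mem, by rw [rotPhase_k02]; exact phase_pow3_mul_ne_one _ _ hf⟩
  · exact ⟨k03, k03_mem, by rw [rotPhase_k03]; exact phase_pow3_mul_ne_one _ _ hf⟩

/-- **S₀ KILLS MIXED WORDS**: both sides of an `S₀`-invariant design have vanishing coefficient on every mixed-phase word. -/
theorem S0_kills_mixed (D : Design) (hS : D.S0Invariant) (w : Word) (hw : w.mixedPhase) :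
    linG D.N (fun c => cellCoef c w) = 0 ∧ linG D.P (fun c => cellCoef c w) = 0 ∧ D.T w = 0 := by
  obtain ⟨k, hk, hρ⟩ := exists_S0_phase_ne_one w hw
  have hN : ∀ c, mPL D.N (rotCell k c) = mPL D.N c := fun c => (hS k hk c).1
  have hP : ∀ c, mPL D.P (rotCell k c) = mPL D.P c := fun c => (hS k hk c).2
  have zN := linG_eq_zero_of_phase D.N k hN w hρ
  have zP := linG_eq_zero_of_phase D.P k hP w hρ
  exact ⟨zN, zP, by rw [T_eq_linG, zN, zP, sub_zero]⟩

theorem phase_eq_one_iff (s : Sym) : s.phase = 1 ↔ s.efree = true := by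
  cases s <;> simp [Sym.phase, Sym.efree] <;> decide

theorem phase_eq_e_iff (s : Sym) : s.phase = ⟨0, -1⟩ ↔ s = Sym.e := by
  cases s <;> simp [Sym.phase] <;> decide

theorem phase_eq_ebar_iff (s : Sym) : s.phase = ⟨0, 1⟩ ↔ s = Sym.ebar := by
  cases s <;> simp [Sym.phase] <;> decide

/-- The words (A1).1 speaks about — not e-free, not `eeee`, not `ēēēē` — are exactly… in particular mixed-phase. -/
theorem mixedPhase_of_A1_scope (w : Word) (h1 : ¬ w.efree) (h2 : w ≠ Word.eeee) (h3 : w ≠ Word.EEEE) : w.mixedPhase := by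
  by_contra hno
  have hall : ∀ f, (w f).phase = (w 0).phase := fun f => by
    by_contra hf; exact hno ⟨f, hf⟩
  -- classify by the phase of factor 0
  rcases (by cases w 0 <;> simp [Sym.phase] : (w 0).phase = 1 ∨ (w 0).phase = ⟨0, -1⟩ ∨ (w 0).phase = ⟨0, 1⟩)
    with h0 | h0 | h0
  · exact h1 fun f => (phase_eq_one_iff _).mp ((hall f).trans h0)
  · exact h2 (funext fun f => (phase_eq_e_iff _).mp ((hall f).trans h0))
  · exact h3 (funext fun f => (phase_eq_ebar_iff _).mp ((hall f).trans h0))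

/-- **(A1).1 IS AUTOMATIC** for `S₀`-invariant designs. -/
theorem A1_mixed_automatic (D : Design) (hS : D.S0Invariant) :
    ∀ w : Word, ¬ w.efree → w ≠ Word.eeee → w ≠ Word.EEEE → D.T w = 0 :=
  fun w h1 h2 h3 => (S0_kills_mixed D hS w (mixedPhase_of_A1_scope w h1 h2 h3)).2.2

/-- … so (A1) for an `S₀`-invariant design is exactly its e-free half (A1).2. -/
theorem A1_iff_efree_rows (D : Design) (hS : D.S0Invariant) :
    D.A1 ↔ ∀ w w' : Word, w.efree → w'.efree → w.deg = w'.deg → D.T w = D.T w' :=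
  ⟨fun h => h.2, fun h => ⟨A1_mixed_automatic D hS, h⟩⟩

end s0kills

/-! ## μ IN ORBIT FORM (strengthen g6): `eeee` is phase-pure (all phases `−i`), `ρ(eeee,k) = (−i)^{Σk} = 1` on `S₀`, so the single
P-orbit contributes `64·∏_f β̄(x₀,f)` and `μ = Σ_N m·cellCoef(·,eeee) − 64·∏_f star β_f(x₀)`.  Together with `A1_iff_efree_rows`,
`A1_rows_profile`, `sumN_window`, `N_above_orbit` this types every hypothesis of `DBSym` in PROFILE form. -/

section muorbit

theorem phase_e_pow_four : Sym.phase Sym.e ^ 4 = 1 := by decide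

theorem rotPhase_eeee (k : Fin 4 → Fin 4) (hk : InS0 k) : Word.eeee.rotPhase k = 1 := by
  unfold Word.rotPhase
  unfold InS0 at hk
  simp only [Word.eeee]
  rw [Finset.prod_pow_eq_pow_sum, ← Nat.mod_add_div (∑ f : Fin 4, (k f).val) 4, hk, zero_add, pow_mul,
    phase_e_pow_four, one_pow]

theorem P_entries_in_orbit (D : Design) (hS : D.S0Invariant) (hA : D.OnAlphabet 14) (h4 : D.A4sharp) (hC : D.CONN)
    (hB : D.copies ≤ 199) (hr : 8 ≤ D.rank) (x₀ : Cell) (hx₀ : x₀ ∈ D.suppP) :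
    ∀ cm ∈ D.P, 0 < cm.2 → cm.1 ∈ orbitP x₀ := by
  intro cm hcm hpos
  have hmem : cm.1 ∈ D.suppP := (mem_suppP_iff D cm.1).mpr ⟨cm.2, by simpa using hcm, hpos⟩
  obtain ⟨k, hk, hk'⟩ := one_orbit D hS hA h4 hC hB hr x₀ hx₀ cm.1 hmem
  rw [hk']
  exact rotCell_mem_orbitP k hk x₀

theorem cellCoef_eeee (c : Cell) : cellCoef c Word.eeee = ∏ f : Fin 4, star (c f).beta := by
  unfold cellCoef; simp [Word.eeee, Sym.coef]

/-- The P side of `μ` is one orbit: `Σ_P m·cellCoef(·, eeee) = 64 · cellCoef(x₀, eeee)`. -/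
theorem linGP_eeee (D : Design) (hS : D.S0Invariant) (hA : D.OnAlphabet 14) (h4 : D.A4sharp) (hC : D.CONN)
    (hB : D.copies ≤ 199) (hr : 8 ≤ D.rank) (x₀ : Cell) (hx₀ : x₀ ∈ D.suppP) :
    linG D.P (fun c => cellCoef c Word.eeee) = 64 * cellCoef x₀ Word.eeee := by
  have hxf := suppP_x_ne_zero D hA h4 hC x₀ hx₀
  have h1 : D.mP x₀ = 1 := mP_eq_one D hS hA h4 hC hB hr x₀ hx₀
  rw [linG_eq_sum D.P _ (orbitP x₀) (P_entries_in_orbit D hS hA h4 hC hB hr x₀ hx₀)]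
  have key : ∀ c ∈ orbitP x₀, (mPL D.P c : GaussianInt) * cellCoef c Word.eeee = cellCoef x₀ Word.eeee := by
    intro c hc
    obtain ⟨t, rfl⟩ := (mem_orbitP x₀ c).mp hc
    rw [← mP_eq_mPL, mP_rotCell D hS (s0of t) (s0of_mem t) x₀, h1, cellCoef_rotCell_phase, rotPhase_eeee _ (s0of_mem t)]
    simp
  rw [Finset.sum_congr rfl key, Finset.sum_const, card_orbitP x₀ hxf, nsmul_eq_mul]
  norm_num

/-- **μ NORMAL FORM** under the DB-SYM hypotheses. -/
theorem mu_normal_form (D : Design) (hS : D.S0Invariant) (hA : D.OnAlphabet 14) (h4 : D.A4sharp) (hC : D.CONN)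
    (hB : D.copies ≤ 199) (hr : 8 ≤ D.rank) (x₀ : Cell) (hx₀ : x₀ ∈ D.suppP) :
    D.mu = linG D.N (fun c => cellCoef c Word.eeee) - 64 * ∏ f : Fin 4, star (x₀ f).beta := by
  unfold Design.mu
  rw [T_eq_linG, linGP_eeee D hS hA h4 hC hB hr x₀ hx₀, cellCoef_eeee]

end muorbit

/-! ## DB-SYM IN PROFILE FORM (strengthen g6): the hand-off statement.  `DBSym_of_profile : DBSymProfile → DBSym` — after ONE-ORBIT,
S₀-KILLS-MIXED, the PROFILE NORMAL FORM and the μ NORMAL FORM, proving `DBSym` amounts to refuting, for every off-axis profile `x₀` and every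
`S₀`-invariant N side, the e-free equal-degree rows together with `Σ_N m·cellCoef(·,eeee) ≠ 64·∏ star β(x₀)`. -/

section profileform

/-- PROFILE form of DB-SYM (the prover's remaining target; colour-1's LP room l.8512 with phases and integrality kept). -/
def DBSymProfile : Prop :=
  ∀ D : Design, ∀ x₀ : Cell, D.S0Invariant → D.OnAlphabet 14 → D.A4sharp → D.CONN → D.copies ≤ 199 → 8 ≤ D.rank →
    x₀ ∈ D.suppP →
    (∀ w w' : Word, w.efree → w'.efree → w.deg = w'.deg →
        linZ D.N (fun c => icellCoef c w) - linZ D.N (fun c => icellCoef c w') = 64 * (icellCoef x₀ w - icellCoef x₀ w')) →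
    linG D.N (fun c => cellCoef c Word.eeee) ≠ 64 * ∏ f : Fin 4, star (x₀ f).beta → False

theorem exists_suppN_of_rank (D : Design) (hr : 8 ≤ D.rank) : ∃ y, y ∈ D.suppN := by
  by_contra hno
  have h0 : (D.N.map Prod.snd).sum = 0 := by
    apply List.sum_eq_zero
    intro m hm
    obtain ⟨cm, hcm, rfl⟩ := List.mem_map.mp hm
    by_contra hne
    exact hno ⟨cm.1, (mem_suppN_iff D cm.1).mpr ⟨cm.2, by simpa using hcm, Nat.pos_of_ne_zero hne⟩⟩
  unfold Design.rank at hr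
  rw [h0] at hr
  omega

theorem DBSym_of_profile (h : DBSymProfile) : DBSym := by
  intro D hS hA hA1 hmu hr h4 hC hB
  obtain ⟨y, hy⟩ := exists_suppN_of_rank D hr
  obtain ⟨x₀, hx₀, _⟩ := hC.2 y hy
  refine h D x₀ hS hA h4 hC hB hr hx₀ (A1_rows_profile D hS hA hA1 h4 hC hB hr x₀ hx₀) ?_
  intro heq
  apply hmu
  rw [mu_normal_form D hS hA h4 hC hB hr x₀ hx₀, heq, sub_self]

end profileform

/-! ## Registered stubs (director R19.374 (2): «the theorem may start as a registered sorry stub»; prover brief = colour-1 memo §4) -/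

/-- STUB 1 — DB-SYM (first prover target: all depths, no `c₀`). -/
theorem stub_DBSym : DBSym := by
  sorry

/-- STUB 2 — THE CONJECTURE OF RECORD (colour-1 l.8441 numeral `c₀ = 3`; director R19.377 (1) ADOPTED verbatim):
`DepthBound 14 199 8 3`.  CLOSURE(Leg A) ⇔ this ∧ `RingsEmpty 14 199 8 3` (`a4_closed_of_depthBound_and_rings`); each ring `c` the kit
certifies EMPTY relaxes the owed lemma to `DepthBound 14 199 8 c` (`depthBound_mono`); the prover's descending rungs are
`DepthBound 14 199 8 13` («no supported letter has a = 0») → `… 12` → ….  OPEN — no `c₀ < 14` is proved; FALSE ⇔ a ring-≥4 four-ample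
(A1) design with `μ ≠ 0`, `r ≥ 8`, `M ≤ 199` exists = the construction's next address (either outcome wanted, R19.374 (2)). -/
theorem stub_depthBound_three : DepthBound 14 199 8 3 := by
  sorry

/-- colour-1's six-hypothesis form DB(3) follows from the conjecture of record (it has MORE hypotheses). -/
theorem DB_three_of_depthBound_three (h : DepthBound 14 199 8 3) : DB 3 :=
  depthBoundC1_of_depthBoundP 14 199 8 3 (depthBoundP_of_depthBound 14 199 8 3 h)

end Summit.HodgeConjecture.HodgeConjecture.Cruxes.BlochSeedDiscOne.DepthBoundA4
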